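import Literature.AlgebraicGeometry.HodgeTheory.ThetaTraceTimesCMProductSpan
import Literature.AlgebraicGeometry.HodgeTheory.AbelianFourfoldEndRankOneHodgeClasses
import Literature.AlgebraicGeometry.Motives.HodgeLieCentreThetaTraceCondition
import Literature.AlgebraicGeometry.Milne1999.HodgeGroupPowersDiagonal
import Literature.AlgebraicGeometry.HodgeTheory.HodgeGroupExteriorAction
import HarnessLib

/-!
# A complex abelian variety whose Hodge group has FINITE CENTRE satisfies the `Θ`-trace condition, and conversely when the centre of `End⁰(A)` lies in a field `ℚ(φ)`; DISCHARGE of the named fact `Gordon1999_hodgeClassesProductSpan_of_semisimple`; semisimple `Hg` ⟹ the Weil classes of every `ℚ(φ) ⊆ End⁰(A)` are Hodge (Gordon 1999 §3 + 2.16 (1) + 2.12 + 2.9; Silverberg–Zarhin 1996; Moonen–Zarhin 1998 §1, 1999 (3.1))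

HONEST FRAMING: research route conditional on HC_CM; not a corollary; Q11.4-sentence-2 already refuted in dim ≥ 3.
(This file proves theorems about the Hodge structures of complex abelian varieties; no summit statement is touched,
HC_CM is not used, nothing here is a step towards the Hodge conjecture beyond the published results it formalizes.)

## What is proved

* `hodgeThetaTraceCondition_of_hasSemisimpleHodgeGroup` — the link recorded as missing in
  `HodgeTheory/ThetaTraceTimesCMProductSpan` («BYPASSED, NOT discharged … "finite centre ⟹ trace condition" needs
  connectedness of `Hg`, not in the tree»): `HasSemisimpleHodgeGroup A` (finite centre of the Tannaka-free carrier
  `Hg(A)(ℂ) = hodgeGroup A.dim A.X`) ⟹ `HodgeThetaTraceCondition A`. Connectedness is not needed: the proof goes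
  through the Lie algebra and explicit ONE-PARAMETER FAMILIES in the centre.
* `Gordon1999_hodgeClassesProductSpan_of_semisimple_holds` — the named fact of
  `HodgeTheory/HodgeGroupProductSemisimpleCMFactor` AS TYPED (`∀ A C, HasSemisimpleHodgeGroup A → IsOfCMType C →
  HodgeClassesProductSpan A C`), by the link and the tree's `hodgeClassesProductSpan_of_thetaTrace_of_isOfCMType`
  (Moonen–Zarhin (3.1) through the tree's infinitesimal invariant theory). The `_holds` cannot sit next to the `def`:
  the proof imports the product-span file, which imports the fact's file. Binder-free corollaries:
  `hodgeClassesProductSpan_of_hasSemisimpleHodgeGroup_of_isOfCMType`, `hodgeConjectureFor_prod_iff_of_hasSemisimpleHodgeGroup`,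
  `forall_prod_cmType_iff_cmHodgeHypothesis_of_hasSemisimpleHodgeGroup`; every row of the tree with a binder
  `(hG : Gordon1999_hodgeClassesProductSpan_of_semisimple)` can now be fed `…_holds`.
* §5 (the converse direction): `eigenMultiplicity_eq_of_hodgeThetaTraceCondition` — under the `Θ`-trace condition the
  multiplicities of EVERY `φ ∈ End(A)` with irreducible polynomial `P` are balanced, `n_ρ = n_ρ̄` at every root (no
  centrality of `φ`): `tr(Θ ∘ q(φ^*)) = 0` for all complex polynomials `q` (`Motives/HodgeLieCentreThetaTraceCondition`
  §4) against `tr(Θ ∘ q(φ^*)) = ∑_ρ q(ρ)(n_ρ - n_ρ̄)` with a Lagrange polynomial `q`; hence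
  `weilClassesField_le_hodgeClassSpan_of_hasSemisimpleHodgeGroup` («`Hdg(X)` semi-simple ⟹ `Hdg(X) ⊂ Sl_F(V_X)` ⟹ `W_F`
  consists of Hodge classes», Moonen–Zarhin §1, with their Criterion in the tree's form
  `Deligne1982.weilClassesField_le_hodgeClassSpan_iff_forall_eigenMultiplicity_eq`), `eigenMultiplicity_eq_of_hasSemisimpleHodgeGroup`,
  and — when the centre of `End⁰(A)` lies in `ℚ(φ)` (the tree's hypothesis block `hE`, `e · 2m = 2 dim A`, `m ≠ 0` of
  `hasSemisimpleHodgeGroup_of_forall_eigenMultiplicity_eq`) — `hasSemisimpleHodgeGroup_of_hodgeThetaTraceCondition` and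
  GORDON 2.9 AS AN EQUIVALENCE on the carrier: `hasSemisimpleHodgeGroup_iff_hodgeThetaTraceCondition`,
  `hasSemisimpleHodgeGroup_iff_forall_eigenMultiplicity_eq`, `hasSemisimpleHodgeGroup_iff_weilClassesField_le_hodgeClassSpan`.
* §6: the numerics `e · 2m = 2 dim A`, `m ≠ 0` follow from balance (`natDegree_mul_two_mul_eigenMultiplicity_eq_of_hodgeThetaTraceCondition`,
  with the tree's `finrank_eigenspace_mul_natDegree_eq`): `hasSemisimpleHodgeGroup_iff_hodgeThetaTraceCondition_of_dim_pos`,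
  `hasSemisimpleHodgeGroup_iff_forall_eigenMultiplicity_eq_of_dim_pos` need only `dim A > 0`, `P(φ) = 0` irreducible and `hE`.

## The argument (Gordon 2.9 = Silverberg–Zarhin; Moonen–Zarhin 1998 §1 Remark (1); Deligne I §3)

In print: «`Hg(A)` is semisimple» ⟺ «the centre of `End⁰(A)` acts with balanced multiplicities» (Gordon 2.9, citing
Silverberg–Zarhin [B.118]; Moonen–Zarhin 1998 §1 Lemma (1) and Remark (1): `Z(Hg)° ⊂ U_F`, and `Hg ⊂ SU` iff the
multiplicities are balanced). The direction used here: if the centre of `Hg` is finite then `Lie Hg ∩ F = 0` for the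
centre `F` of `End_Hdg(H¹A)`, i.e. `tr(Θ ∘ a) = 0` for all central Hodge endomorphisms `a` — the `Θ`-trace
condition. On the tree's carrier (the subgroup of `∏_k GL(Hᵏ(A(ℂ); ℂ))` of Künneth families fixing the rational
`(p,p)`-classes of all powers) the proof runs:
1. (`Motives/HodgeLieCentreThetaTraceCondition`, abstract Hodge structures) ¬`Θ`-trace ⟹ a nonzero
   `z ∈ 𝔷 = Lie Hg(H¹A) ∩ End_Hdg(H¹A)`, central in `End_Hdg`, skew for every polarization, hence SEMISIMPLE.
2. (§2) INVARIANCE: in a Hodge-adapted eigenbasis `b` of `z_ℂ` (`z_ℂ b_m = μ_m b_m`), every rational `(p,p)`-class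
   of a variety with slots over `A` (all powers `A^{a+1}`) has coefficients supported on the words of `z`-weight
   `∑_t μ_{m_t} = 0` — the tree's Theorem L-Hg `wordDerAt_eq_zero_of_mem_hodgeLieC` (Deligne's rigidity: `Lie Hg`
   kills the Hodge tensors) read on the diagonal matrix of `z_ℂ` (`eq_zero_of_wordDerAt_diagonal_eq_zero`).
3. (§3) the spectral exponentials `U_s` (`U_s b_m = e^{sμ_m} b_m`, `s ∈ ℂ`) lie in `(C(A) ⊗ ℂ)^×` (`z_ℂ = c·F^*`,
   `F ∈ End(A)` central, Riemann: `exists_conj_baseChange_eq_smul_pullbackOne`, and §1), and `⋀•(U_s^{⊕(a+1)})`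
   fixes those classes (letters scale, `diagPow_intertwine_right`; `∏_t e^{sμ_{m_t}} = e^{s·0} = 1`), so
   `⋀•U_s ∈ Hg(A)(ℂ)` (`Milne1999.exteriorPullbackEquiv_mem_hodgeGroup_of_forall`).
4. (§4) `⋀•U_s` is central (`hodgeGroup_ext_one`: an element of `Hg` is determined on `H¹`, where it commutes with
   `End(A)`, `hodgeGroupOne_comm_pullbackOne`, hence with `z_ℂ` and `U_s`, §1), and `k ↦ ⋀•U_{k/μ₀}` (`μ₀ ≠ 0` an
   eigenvalue of `z_ℂ`, which exists as `z ≠ 0`) is injective on `ℕ` — the centre is infinite, contradiction.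

## Not claimed

The converse «`Θ`-trace ⟹ finite centre» is proved only when the centre of `End⁰(A)` lies in a field `ℚ(φ) ⊆ End⁰(A)`
(hypothesis `hE`; e.g. `A` isotypic); for a centre that is a product of several fields the Weil classes of each factor
would be needed and are not in the tree. Nothing here bears on HC_CM or the summit.

## References

* [Gordon1999HodgeAVSurvey] B. B. Gordon, A survey of the Hodge conjecture for abelian varieties (Appendix B to
  J. D. Lewis, A survey of the Hodge conjecture, 2nd ed.), 2.9 Proposition (alg-geom/9709030 p. 11, crediting
  Silverberg–Zarhin [B.118]), 2.12 Proposition, 2.16 Proposition (1), §3 (proof of the Theorem, last step).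
* [MoonenZarhin1998WeilClasses] B. J. J. Moonen, Yu. G. Zarhin, Weil classes on abelian varieties, J. reine angew.
  Math. 496 (1998), §1 Lemma (1) and Remark (1).
* [MoonenZarhin1999LowDim] B. J. J. Moonen, Yu. G. Zarhin, Hodge classes on abelian varieties of low dimension,
  Math. Ann. 315 (1999), §1 and §3 (3.1).
* [Deligne1982HodgeCycles] P. Deligne, Hodge cycles on abelian varieties, in LNM 900 (1982), I §3 Prop. 3.4, 3.6, §4.
* [Milne1999LefschetzClasses] J. S. Milne, Lefschetz classes on abelian varieties, Duke Math. J. 96 (1999), §1 p. 643, §4.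
* [vanGeemen1994HodgeAV] B. van Geemen, An introduction to the Hodge conjecture for abelian varieties, LNM 1594
  (1994), 6.4–6.11.
* [HatcherAT2002] A. Hatcher, Algebraic Topology (2002), §3.1 p. 199, §3.2 Example 3.16.
* [Fulton1998] W. Fulton, Intersection Theory, 2nd ed. (1998), §19.2. [Milne1999] J. S. Milne, Lefschetz motives and
  the Tate conjecture, Compositio Math. 117 (1999), §7 (H).
-/

noncomputable section

open scoped TensorProduct
open CategoryTheory Module

namespace Literature.AlgebraicGeometry.HodgeTheory

open Literature.AlgebraicTopology.SingularHomology
open Literature.AlgebraicGeometry.Motives (IsSmoothProjective AbelianVariety bettiCohomology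
  ofRatClassBaseChange ofRatClassBaseChange_tmul HodgeTensorFacts hodgeTensorFacts_holds ComplexPoints)
open Literature.Barriers.HodgeConjecture
open Literature.AlgebraicGeometry.Motives.HodgeStructure
open Literature.AlgebraicGeometry.ComplexMultiplication
open Literature.RepresentationTheory.GeneralLinear
open Literature.NumberTheory.DiophantineGeometry
open Literature.AlgebraicGeometry.VanGeemen1994 (pullbackOne hodgeGroupOne mem_hodgeGroupOne_iff hodgeClassSpan)
open Literature.AlgebraicGeometry.Milne1999

/-! ### §1 Diagonal operators on an eigenbasis commute with the commutant -/

section Diagonal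

variable {W : Type*} [AddCommGroup W] [Module ℂ W] {M : ℕ}

/-- **An operator that is a function of a diagonalisable one commutes with its commutant.** Let `v` be a basis of
eigenvectors of `g` (`g v_m = μ_m v_m`) and `U` act on `v` by scalars `c_m` depending only on the eigenvalue
(`μ_m = μ_{m'} ⟹ c_m = c_{m'}`). If `T g = g T` then `T U = U T`: `T v_m` has coordinates only along the `v_k` with
`μ_k = μ_m`. (Elementary; the spectral form of «the centre `Z(Hdg) ⊂ U_E` is central in the commutant of `E`».)
[cite: MoonenZarhin1998WeilClasses, §1 Lemma (1)] -/
theorem comp_eq_comp_of_apply_basis_eq_smul (v : Module.Basis (Fin M) ℂ W) {g U T : Module.End ℂ W}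
    (μ c : Fin M → ℂ) (hg : ∀ m, g (v m) = μ m • v m) (hc : ∀ m m', μ m = μ m' → c m = c m')
    (hU : ∀ m, U (v m) = c m • v m) (hT : T * g = g * T) : T * U = U * T := by
  classical
  refine v.ext fun m => ?_
  rw [Module.End.mul_apply, Module.End.mul_apply, hU, map_smul]
  -- coordinates of `T v_m` vanish off the eigenvalue `μ_m`
  have hcoord : ∀ k, μ k ≠ μ m → v.repr (T (v m)) k = 0 := by
    intro k hk
    have h1 : g (T (v m)) = μ m • T (v m) := by
      rw [← Module.End.mul_apply, ← hT, Module.End.mul_apply, hg, map_smul]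
    have h2 : v.repr (g (T (v m))) k = μ k * v.repr (T (v m)) k := by
      conv_lhs => rw [← v.sum_repr (T (v m))]
      rw [map_sum, map_sum]
      simp only [map_smul, hg, Finsupp.coe_finsetSum, Finset.sum_apply, Finsupp.smul_apply,
        Module.Basis.repr_self, smul_eq_mul, Finsupp.single_apply]
      rw [Finset.sum_eq_single k]
      · rw [if_pos rfl]; ring
      · intro k' _ hk'; rw [if_neg hk']; ring
      · intro h; exact absurd (Finset.mem_univ k) h
    rw [h1, map_smul, Finsupp.smul_apply, smul_eq_mul] at h2
    have h3 : (μ m - μ k) * v.repr (T (v m)) k = 0 := by rw [sub_mul]; exact sub_eq_zero.2 h2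
    rcases mul_eq_zero.1 h3 with h | h
    · exact absurd (sub_eq_zero.1 h).symm hk
    · exact h
  -- expand `T v_m` and compare
  conv_lhs => rw [← v.sum_repr (T (v m))]
  conv_rhs => rw [← v.sum_repr (T (v m))]
  rw [map_sum, Finset.smul_sum]
  refine Finset.sum_congr rfl fun k _ => ?_
  rw [map_smul, hU, smul_smul, smul_smul]
  by_cases hk : μ k = μ m
  · rw [hc k m hk, mul_comm]
  · rw [hcoord k hk, zero_mul, mul_zero]

end Diagonal

/-! ### §2 Hodge classes on varieties with slots over `A` are supported on the words of weight zero for the CENTRE of `Lie Hg(H¹ A)` -/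

section Invariance

variable {A X : AbelianVariety ℂ} {n : ℕ} {g : Fin n → (X ⟶ A)}

/-- The two elements of `Fin 2`. [folklore] -/
private theorem fin2_eq_zero_or_one_centre (r : Fin 2) : r = 0 ∨ r = 1 := by
  fin_cases r <;> simp

/-- **An eigenbasis of a semisimple Hodge endomorphism of `H¹(A; ℚ) ⊗ ℂ` adapted to the Hodge decomposition**,
indexed like the rational basis: `z_ℂ b_m = μ_m b_m`, `b_m ∈ H^{1,0}` (kind `0`) or `b_m ∈ H^{0,1}` (kind `1`) — the
simultaneous eigenspace decomposition `V_ℂ = ⊕_{μ,p} (Eig_μ(z_ℂ) ∩ V^{p,1-p})` of a Hodge endomorphism (effective weight one).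
[cite: Deligne1982HodgeCycles, I §3 (proof of Prop. 3.4)] [cite: MoonenZarhin1998WeilClasses, §1 (the multiplicities n_σ)] -/
theorem exists_eigenbasis_hodgeAdapted_hOne [HodgeTensorFacts.{0, 0}] {z : Module.End ℚ (bettiCohomology A.X 1)}
    (hzE : z ∈ (BettiUniverse.hodge exists_isReal_hodgeModel_holds (AbelianVariety.isSmoothProjective_holds (A := A)) 1).endAlg)
    (hss : ⨆ μ, Module.End.eigenspace (z.baseChange ℂ) μ = ⊤) :
    ∃ (b : Module.Basis (Fin (Module.finrank ℚ (bettiCohomology A.X 1))) ℂ (ℂ ⊗[ℚ] bettiCohomology A.X 1))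
      (μ : Fin (Module.finrank ℚ (bettiCohomology A.X 1)) → ℂ) (κ : Fin (Module.finrank ℚ (bettiCohomology A.X 1)) → Fin 2),
      (∀ m, z.baseChange ℂ (b m) = μ m • b m) ∧
      (∀ m, κ m = 0 → b m ∈ (BettiUniverse.hodge exists_isReal_hodgeModel_holds
        (AbelianVariety.isSmoothProjective_holds (A := A)) 1).piece 1 0) ∧
      (∀ m, κ m = 1 → b m ∈ (BettiUniverse.hodge exists_isReal_hodgeModel_holds
        (AbelianVariety.isSmoothProjective_holds (A := A)) 1).piece 0 1) := by
  classical
  have hXA : IsSmoothProjective A.dim A.X := AbelianVariety.isSmoothProjective_holds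
  haveI : Module.Finite ℚ (bettiCohomology A.X 1) := finite_bettiCohomology_one A
  set HA := BettiUniverse.hodge exists_isReal_hodgeModel_holds hXA 1 with hHAdef
  have heff : HA.IsEffective := BettiUniverse.hodge_isEffective exists_isReal_hodgeModel_holds hXA 1
  -- an eigenbasis of `z_ℂ` adapted to the Hodge decomposition
  obtain ⟨N, e, wt, deg, he, -⟩ := exists_basis_mem_eigenspace_inf_piece HA ⟨z, hzE⟩ hss
  have he' : ∀ k, e k ∈ Module.End.eigenspace (z.baseChange ℂ) (wt k) ⊓ HA.piece (deg k) (((1 : ℕ) : ℤ) - deg k) := he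
  have hzk : ∀ k, z.baseChange ℂ (e k) = wt k • e k := fun k => Module.End.mem_eigenspace_iff.1 (he' k).1
  -- the degrees are `0` or `1` (effective weight one; basis vectors are non-zero)
  have hdeg : ∀ k, deg k = 1 ∨ deg k = 0 := by
    intro k
    by_contra hk
    push Not at hk
    have hne : HA.piece (deg k) (((1 : ℕ) : ℤ) - deg k) ≠ ⊥ := by
      intro hbot
      have h := (he' k).2
      rw [hbot] at h
      exact e.ne_zero k ((Submodule.mem_bot ℂ).1 h)
    have h := heff _ _ hne
    omega
  -- kinds: `0` for type `(1,0)`, `1` for type `(0,1)`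
  set κ₀ : Fin N → Fin 2 := fun k => if deg k = 1 then 0 else 1 with hκ₀
  have he0 : ∀ k, κ₀ k = 0 → e k ∈ HA.piece 1 0 := by
    intro k hk
    have hd : deg k = 1 := by
      by_contra h; rw [hκ₀] at hk; simp only [h, if_false] at hk; exact absurd hk one_ne_zero
    have h := (he' k).2
    rw [hd] at h
    simpa using h
  have he1 : ∀ k, κ₀ k = 1 → e k ∈ HA.piece 0 1 := by
    intro k hk
    have hd : deg k = 0 := by
      rcases hdeg k with h | h
      · rw [hκ₀] at hk; simp only [h, if_true] at hk; exact absurd hk zero_ne_one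
      · exact h
    have h := (he' k).2
    rw [hd] at h
    simpa using h
  -- reindex by `Fin M`, `M = dim_ℚ H¹(A; ℚ)`, through the rational basis
  set eC : Module.Basis (Fin (Module.finrank ℚ (bettiCohomology A.X 1))) ℂ (ℂ ⊗[ℚ] bettiCohomology A.X 1) :=
    Algebra.TensorProduct.basis ℂ (Module.finBasis ℚ (bettiCohomology A.X 1)) with heC
  set φ : Fin (Module.finrank ℚ (bettiCohomology A.X 1)) ≃ Fin N := eC.indexEquiv e with hφ
  refine ⟨e.reindex φ.symm, fun m => wt (φ m), fun m => κ₀ (φ m), fun m => ?_, fun m hm => ?_, fun m hm => ?_⟩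
  · rw [Module.Basis.reindex_apply, Equiv.symm_symm, hzk]
  · rw [Module.Basis.reindex_apply, Equiv.symm_symm]; exact he0 _ hm
  · rw [Module.Basis.reindex_apply, Equiv.symm_symm]; exact he1 _ hm

open scoped Classical in
/-- **INVARIANCE under an element of `Lie Hg(H¹(A))` diagonalised on Hodge-adapted letters.** Let `z ∈ Lie Hg(H¹(A; ℚ))`
(the Hodge Lie algebra of the tree's Betti model), `b` a basis of `H¹(A; ℚ) ⊗ ℂ` of eigenvectors of `z_ℂ`
(`z_ℂ b_m = μ_m b_m`) of pure Hodge types recorded by `κ`, and let `X` carry slots `g` over `A`. Then every rational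
`(p,p)`-class on `X` (`p ≥ 1`) is `∑_w a(w) · (g b)_w` in the letters `g_j^* b_m` for a coefficient function `a`
SUPPORTED ON THE WORDS OF `z`-WEIGHT ZERO: `∑_t μ_{m_t} ≠ 0 ⟹ a(w) = 0` for `w = ((j_t, m_t))_t`. Proof: the rational
coefficient tensor `q` of `c` is killed by the matrix of `Θ` (kind balance), hence by the matrix of every element of
`Lie Hg(H¹A) ⊗ ℂ` (the tree's Theorem L-Hg `wordDerAt_eq_zero_of_mem_hodgeLieC`: Deligne's rigidity `hodgeLie_rigid`
applied to the rational annihilator `annLie` of `q`), in particular by `z_ℂ`, which is `diag(μ)` in the letters `b`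
(`wordDerAt_diagonal_apply`). For `z` CENTRAL this is «the Hodge tensors are invariants of the central torus `Z(Hg)°`»,
infinitesimally. [cite: Deligne1982HodgeCycles, I §3 Prop. 3.4 and its proof] [cite: MoonenZarhin1999LowDim, §3 (3.1)]
[cite: MoonenZarhin1998WeilClasses, §1 Lemma (1)] -/
theorem AVSlots.exists_coeff_eq_zero_off_weightZero_of_mem_hodgeLie [HodgeTensorFacts.{0, 0}] (hg : AVSlots A X g)
    {z : Module.End ℚ (bettiCohomology A.X 1)}
    (hz𝔥 : z ∈ (BettiUniverse.hodge exists_isReal_hodgeModel_holds (AbelianVariety.isSmoothProjective_holds (A := A)) 1).hodgeLie)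
    (b : Module.Basis (Fin (Module.finrank ℚ (bettiCohomology A.X 1))) ℂ (ℂ ⊗[ℚ] bettiCohomology A.X 1))
    (μ : Fin (Module.finrank ℚ (bettiCohomology A.X 1)) → ℂ) (κ : Fin (Module.finrank ℚ (bettiCohomology A.X 1)) → Fin 2)
    (hzb : ∀ m, z.baseChange ℂ (b m) = μ m • b m)
    (hb0 : ∀ m, κ m = 0 → b m ∈ (BettiUniverse.hodge exists_isReal_hodgeModel_holds
      (AbelianVariety.isSmoothProjective_holds (A := A)) 1).piece 1 0)
    (hb1 : ∀ m, κ m = 1 → b m ∈ (BettiUniverse.hodge exists_isReal_hodgeModel_holds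
      (AbelianVariety.isSmoothProjective_holds (A := A)) 1).piece 0 1)
    {p : ℕ} (hp : 0 < p) {c : complexBetti X.X (2 * p)} (hcQ : IsRationalClass c)
    (hc : IsOfHodgeType X.dim X.X (2 * p) p p c) :
    ∃ a : (Fin (2 * p) → Fin n × Fin (Module.finrank ℚ (bettiCohomology A.X 1))) → ℂ,
      wordEval (cupPowOneAlt ℂ (ComplexPoints X.X) (2 * p))
        (avLetters g fun m => ofRatClassBaseChange (ComplexPoints A.X) 1 (b m)) a = c ∧
      ∀ w : Fin (2 * p) → Fin n × Fin (Module.finrank ℚ (bettiCohomology A.X 1)), (∑ t, μ (w t).2) ≠ 0 → a w = 0 := by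
  classical
  -- the setting
  have hI : hodgePQ_independent_of_hodgeModel := hodgePQ_independent_of_hodgeModel_holds
  have hXA : IsSmoothProjective A.dim A.X := AbelianVariety.isSmoothProjective_holds
  haveI : Module.Finite ℚ (bettiCohomology A.X 1) := finite_bettiCohomology_one A
  set HA := BettiUniverse.hodge exists_isReal_hodgeModel_holds hXA 1 with hHAdef
  obtain ⟨ψ⟩ : HA.IsPolarizable :=
    smoothProjective_hodgeStructure_isPolarizable_holds hXA (BettiUniverse.realHodgeModel exists_isReal_hodgeModel_holds hXA)
      (BettiUniverse.realHodgeModel_isHodgeSymmetric exists_isReal_hodgeModel_holds hXA) 1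
  set eQ := Module.finBasis ℚ (bettiCohomology A.X 1) with heQ
  set eC : Module.Basis (Fin (Module.finrank ℚ (bettiCohomology A.X 1))) ℂ (ℂ ⊗[ℚ] bettiCohomology A.X 1) :=
    Algebra.TensorProduct.basis ℂ eQ with heC
  -- letters
  set ρ := ofRatClassBaseChangeEquiv hXA 1 with hρ
  set v : Module.Basis _ ℂ (complexBetti A.X 1) := b.map ρ with hv
  set eL : Module.Basis _ ℂ (complexBetti A.X 1) := eC.map ρ with heL
  have heLQ : ∀ i, IsRationalClass (eL i) := fun i => by
    rw [heL, Module.Basis.map_apply, heC, Algebra.TensorProduct.basis_apply, hρ,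
      ofRatClassBaseChangeEquiv_apply, ofRatClassBaseChange_tmul, one_smul]
    exact isRationalClass_ofRatClass _
  have hv_apply : ∀ m, v m = ofRatClassBaseChange (ComplexPoints A.X) 1 (b m) := fun m => by
    rw [hv, Module.Basis.map_apply, hρ, ofRatClassBaseChangeEquiv_apply]
  have hv0 : ∀ m, κ m = 0 → IsOfHodgeType A.dim A.X 1 1 0 (v m) := by
    intro m hm
    rw [hv_apply, ← BettiUniverse.mem_hodge_piece_iff exists_isReal_hodgeModel_holds hI hXA (k := 1) (p := 1) (q := 0) rfl]
    exact hb0 m hm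
  have hv1 : ∀ m, κ m = 1 → IsOfHodgeType A.dim A.X 1 0 1 (v m) := by
    intro m hm
    rw [hv_apply, ← BettiUniverse.mem_hodge_piece_iff exists_isReal_hodgeModel_holds hI hXA (k := 1) (p := 0) (q := 1) rfl]
    exact hb1 m hm
  -- (α) an antisymmetric kind-balanced coefficient function in the adapted letters
  obtain ⟨ax, hax_bal, hax_anti, hcax⟩ := hg.exists_antisymm_kindBalanced_wordEval_eq v κ hv0 hv1 hp hc
  -- the change of letters to the rational letters
  set G : Matrix _ _ ℂ := eC.toMatrix b with hG
  set G' : Matrix _ _ ℂ := b.toMatrix eC with hG'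
  have hG'G : G' * G = 1 := b.toMatrix_mul_toMatrix_flip eC
  have hve : ∀ m, v m = ∑ i, G i m • eL i := fun m => by
    simp only [hv, heL, Module.Basis.map_apply, ← map_smul, ← map_sum]
    congr 1
    exact (eC.sum_toMatrix_smul_self (v := ⇑b) (j := m)).symm
  have hletters : ∀ j m, avLetters g v (j, m) = ∑ i, G i m • avLetters g eL (j, i) :=
    avLetters_baseChange g G hve
  set aE := colourChangeAt (fun _ : Fin n => G) ax with haE
  have haE_anti : IsAntisymm aE := hax_anti.colourChangeAt _
  have hcaE : wordEval (cupPowOneAlt ℂ (ComplexPoints X.X) (2 * p)) (avLetters g eL) aE = c := by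
    rw [haE, ← wordEval_eq_wordEval_colourChangeAt _ (fun _ : Fin n => G) hletters ax, hcax]
  -- rationality of `aE`
  have hFinj : Function.Injective (exteriorPower.alternatingMapLinearEquiv
      (cupPowOneAlt ℂ (ComplexPoints X.X) (2 * p))) :=
    injective_alternatingMapLinearEquiv_cupPowOneAlt X (2 * p)
  obtain ⟨q, hq⟩ := hg.exists_rat_wordEval_eq eL heLQ hcQ
  obtain ⟨q', -, haEq⟩ := haE_anti.exists_eq_algebraMap_of_wordEval_eq hFinj (hg.letterBasis eL)
    (q := q) (by rw [AVSlots.coe_letterBasis, hcaE, hq])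
  have hslice_e : ∀ u, wordSlice aE u = wordRepAt ℂ (fun _ : Fin (2 * p) => G) (wordSlice ax u) :=
    fun u => wordSlice_colourChangeAt (fun _ : Fin n => G) ax u
  -- the Hodge operator `Θ` of `H¹(A)`: `diag(±1)` in the adapted letters
  obtain ⟨Θ, hΘ⟩ := exists_hodgeTheta HA
  have hΘb : ∀ m, Θ (b m) = (if κ m = 0 then (1 : ℂ) else -1) • b m := by
    intro m
    rcases fin2_eq_zero_or_one_centre (κ m) with h0 | h1
    · rw [h0, if_pos rfl]
      have hmem : b m ∈ HA.piece 1 (((1 : ℕ) : ℤ) - 1) := by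
        have e1 : (((1 : ℕ) : ℤ) - 1) = 0 := by norm_num
        rw [e1]; exact hb0 m h0
      rw [hΘ 1 _ hmem]
      norm_num
    · rw [h1, if_neg one_ne_zero]
      have hmem : b m ∈ HA.piece 0 (((1 : ℕ) : ℤ) - 0) := by
        have e1 : (((1 : ℕ) : ℤ) - 0) = 1 := by norm_num
        rw [e1]; exact hb1 m h1
      rw [hΘ 0 _ hmem]
      norm_num
  have hΘcb : LinearMap.toMatrix b b Θ = kindDiag κ := by
    ext i m
    rw [LinearMap.toMatrix_apply, hΘb, map_smul, Module.Basis.repr_self, Finsupp.smul_apply,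
      Finsupp.single_apply, kindDiag, Matrix.diagonal_apply, smul_eq_mul, mul_ite, mul_one, mul_zero]
    by_cases him : i = m
    · subst him; rw [if_pos rfl]
    · rw [if_neg (Ne.symm him), if_neg him]
  have hJG : LinearMap.toMatrix eC eC Θ * G = G * kindDiag κ := by
    rw [← hΘcb, hG, linearMap_toMatrix_mul_basis_toMatrix, basis_toMatrix_mul_linearMap_toMatrix]
  have hΘq : ∀ u : Fin (2 * p) → Fin n, wordDerAt ℂ (fun _ : Fin (2 * p) => LinearMap.toMatrix eC eC Θ)
      (wordSlice (fun w => algebraMap ℚ ℂ (q' w)) u) = 0 := by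
    intro u
    rw [← haEq, hslice_e]
    refine wordDerAt_wordRepAt_eq_zero_of_mul_eq ℂ (fun _ : Fin (2 * p) => G) (fun _ => hJG) ?_
    rw [wordDerAt_const]
    exact wordDer_kindDiag_wordSlice_eq_zero κ hax_bal u
  -- THEOREM L-Hg: `z_ℂ ∈ Lie Hg(H¹A) ⊗ ℂ` kills the rational coefficient tensor
  have hzC : z.baseChange ℂ ∈ HA.hodgeLieC := baseChange_mem_hodgeLieC HA hz𝔥
  have hL : ∀ u : Fin (2 * p) → Fin n, wordDerAt ℂ (fun _ : Fin (2 * p) => LinearMap.toMatrix eC eC (z.baseChange ℂ))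
      (wordSlice (fun w => algebraMap ℚ ℂ (q' w)) u) = 0 := fun u =>
    wordDerAt_eq_zero_of_mem_hodgeLieC HA ψ eQ q' hΘ hΘq hzC u
  -- `z_ℂ = diag(μ)` in the adapted letters
  have hzcb : LinearMap.toMatrix b b (z.baseChange ℂ) = Matrix.diagonal μ := by
    ext i m
    rw [LinearMap.toMatrix_apply, hzb, map_smul, Module.Basis.repr_self, Finsupp.smul_apply,
      Finsupp.single_apply, Matrix.diagonal_apply, smul_eq_mul, mul_ite, mul_one, mul_zero]
    by_cases him : i = m
    · subst him; rw [if_pos rfl]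
    · rw [if_neg (Ne.symm him), if_neg him]
  have hYG : ∀ _t : Fin (2 * p), LinearMap.toMatrix eC eC (z.baseChange ℂ) * G = G * Matrix.diagonal μ := fun _ => by
    rw [← hzcb, hG, linearMap_toMatrix_mul_basis_toMatrix, basis_toMatrix_mul_linearMap_toMatrix]
  -- `diag(μ)` kills the coefficient tensor in the adapted letters
  have hax : ∀ u : Fin (2 * p) → Fin n, wordDerAt ℂ (fun _ : Fin (2 * p) => Matrix.diagonal μ) (wordSlice ax u) = 0 := by
    intro u
    have hLu := hL u
    rw [← haEq, hslice_e] at hLu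
    have h3 : wordRepAt ℂ (fun _ : Fin (2 * p) => G)
        (wordDerAt ℂ (fun _ : Fin (2 * p) => Matrix.diagonal μ) (wordSlice ax u)) = 0 := by
      rw [wordRepAt_wordDerAt_of_mul_eq ℂ (fun _ : Fin (2 * p) => G) hYG, hLu]
    exact wordRepAt_injective ℂ (g := fun _ : Fin (2 * p) => G) (g' := fun _ : Fin (2 * p) => G')
      (funext fun _ => hG'G) (by rw [h3, map_zero])
  -- read off the weights
  refine ⟨ax, ?_, fun w hw => ?_⟩
  · have hfun : (fun m => ofRatClassBaseChange (ComplexPoints A.X) 1 (b m)) = ⇑v := funext fun m => (hv_apply m).symm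
    rw [hfun, hcax]
  · have h1 := hax fun t => (w t).1
    have h2 := eq_zero_of_wordDerAt_diagonal_eq_zero (fun _ : Fin (2 * p) => μ) h1 (fun t => (w t).2) hw
    rw [wordSlice_apply] at h2
    exact h2

end Invariance

/-! ### §3 The spectral exponentials of a central element fix the Hodge classes of every power -/

section Fixing

variable {A : AbelianVariety ℂ}

/-- **Letters scale, monomials scale by the product.** For `U ∈ (C(A) ⊗ ℂ)^×` diagonal on letters
`v_m ∈ H¹(A(ℂ); ℂ)`, `U v_m = f_m v_m`, the exterior action `⋀•(U^{⊕(a+1)})` on `H•(A^{a+1})` multiplies the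
monomial `(g v)_w = g_{j_1}^* v_{m_1} ∪ ⋯ ∪ g_{j_d}^* v_{m_d}` in the slot letters of `A^{a+1}` by `∏_t f_{m_t}`
(`U^{⊕(a+1)} g_j^* = g_j^* U`, `diagPow_intertwine_right`; multilinearity of the cup product).
[cite: Milne1999LefschetzClasses, §1 p. 643] [cite: HatcherAT2002, §3.2 Example 3.16] -/
theorem diagPowExterior_cupPowOne_avLetters_eq_prod_smul {U : complexBetti A.X 1 ≃ₗ[ℂ] complexBetti A.X 1}
    (hU : U ∈ centralizerGroup A) {M : ℕ} (v : Fin M → complexBetti A.X 1) (f : Fin M → ℂ)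
    (hUv : ∀ m, U (v m) = f m • v m) (a d : ℕ) (w : Fin d → Fin (a + 1) × Fin M) :
    diagPowExterior A U a d (cupPowOne ℂ (ComplexPoints (A.powSucc a).X) d (avLetters (avPowSlots A a) v ∘ w)) =
      (∏ t, f (w t).2) • cupPowOne ℂ (ComplexPoints (A.powSucc a).X) d (avLetters (avPowSlots A a) v ∘ w) := by
  rw [diagPowExterior, exteriorPullbackEquiv_apply, exteriorPullback_cupPowOne, ← MultilinearMap.map_smul_univ]
  refine congrArg _ (funext fun i => ?_)
  show diagPow A U a (complexBetti.map (avPowSlots A a (w i).1).hom.hom.hom 1 (v (w i).2)) =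
    f (w i).2 • complexBetti.map (avPowSlots A a (w i).1).hom.hom.hom 1 (v (w i).2)
  rw [diagPow_intertwine_right hU, hUv, map_smul]

/-- **The spectral exponentials of a central element of `Lie Hg(H¹A)` fix every Hodge class of every power.**
With `z ∈ Lie Hg(H¹(A; ℚ))`, a Hodge-adapted eigenbasis `b` (`z_ℂ b_m = μ_m b_m`) and `U ∈ (C(A) ⊗ ℂ)^×` diagonal
on the letters `b_m` with eigenvalues `f_m` satisfying `∑_t μ_{m_t} = 0 ⟹ ∏_t f_{m_t} = 1` (e.g. `f_m = exp(s μ_m)`),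
`⋀•(U^{⊕(a+1)})` fixes every rational `(p,p)`-class of every `A^{a+1}`: such a class is supported on the words of
`z`-weight zero (§2), on which `U` acts by `∏_t f_{m_t} = 1`; in degree `0` the class is a multiple of `1`.
(«the Hodge classes are the invariants of `Hg`; its centre acts through characters trivial on them».)
[cite: Deligne1982HodgeCycles, I §3 Prop. 3.4 and its proof] [cite: MoonenZarhin1999LowDim, §3 (3.1)]
[cite: Milne1999LefschetzClasses, §1 p. 643] -/
theorem diagPowExterior_apply_eq_self_of_eigenletters [HodgeTensorFacts.{0, 0}]
    {z : Module.End ℚ (bettiCohomology A.X 1)}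
    (hz𝔥 : z ∈ (BettiUniverse.hodge exists_isReal_hodgeModel_holds (AbelianVariety.isSmoothProjective_holds (A := A)) 1).hodgeLie)
    (b : Module.Basis (Fin (Module.finrank ℚ (bettiCohomology A.X 1))) ℂ (ℂ ⊗[ℚ] bettiCohomology A.X 1))
    (μ : Fin (Module.finrank ℚ (bettiCohomology A.X 1)) → ℂ) (κ : Fin (Module.finrank ℚ (bettiCohomology A.X 1)) → Fin 2)
    (hzb : ∀ m, z.baseChange ℂ (b m) = μ m • b m)
    (hb0 : ∀ m, κ m = 0 → b m ∈ (BettiUniverse.hodge exists_isReal_hodgeModel_holds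
      (AbelianVariety.isSmoothProjective_holds (A := A)) 1).piece 1 0)
    (hb1 : ∀ m, κ m = 1 → b m ∈ (BettiUniverse.hodge exists_isReal_hodgeModel_holds
      (AbelianVariety.isSmoothProjective_holds (A := A)) 1).piece 0 1)
    {U : complexBetti A.X 1 ≃ₗ[ℂ] complexBetti A.X 1} (hU : U ∈ centralizerGroup A)
    (f : Fin (Module.finrank ℚ (bettiCohomology A.X 1)) → ℂ)
    (hUv : ∀ m, U (ofRatClassBaseChange (ComplexPoints A.X) 1 (b m)) = f m • ofRatClassBaseChange (ComplexPoints A.X) 1 (b m))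
    (hf : ∀ {d : ℕ} (m : Fin d → Fin (Module.finrank ℚ (bettiCohomology A.X 1))), (∑ t, μ (m t)) = 0 → ∏ t, f (m t) = 1)
    (a p : ℕ) (c : complexBetti (A.powSucc a).X (2 * p)) (hcQ : IsRationalClass c)
    (hc : IsOfHodgeType (A.powSucc a).dim (A.powSucc a).X (2 * p) p p c) :
    diagPowExterior A U a (2 * p) c = c := by
  classical
  rcases Nat.eq_zero_or_pos p with rfl | hp
  · -- degree `0`: `c = t • 1` and `⋀⁰ = id` on `1`
    obtain ⟨t, rfl⟩ := exists_eq_smul_one_of_isSmoothProjective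
      (AbelianVariety.isSmoothProjective_holds (A := A.powSucc a)) ℂ c
    rw [map_smul]
    congr 1
    show diagPowExterior A U a 0 _ = _
    rw [diagPowExterior, exteriorPullbackEquiv_apply, exteriorPullback_one]
  · obtain ⟨ax, hax, hsupp⟩ := (AVSlots.powSucc A a).exists_coeff_eq_zero_off_weightZero_of_mem_hodgeLie hz𝔥 b μ κ
      hzb hb0 hb1 hp hcQ hc
    rw [← hax, wordEval_apply, map_sum]
    refine Finset.sum_congr rfl fun w _ => ?_
    rw [map_smul, cupPowOneAlt_apply,
      diagPowExterior_cupPowOne_avLetters_eq_prod_smul hU (fun m => ofRatClassBaseChange (ComplexPoints A.X) 1 (b m)) f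
        hUv a (2 * p) w]
    by_cases hw : (∑ t, μ (w t).2) = 0
    · rw [hf (fun t => (w t).2) hw, one_smul]
    · rw [hsupp w hw, zero_smul, zero_smul]

end Fixing

/-! ### §4 Finite centre ⟹ the `Θ`-trace condition; Gordon's product fact discharged -/

section Main

/-- **FINITE CENTRE OF `Hg(A)(ℂ)` ⟹ THE `Θ`-TRACE CONDITION** («`Hg(A)` semisimple ⟹ no central Weil-type
character»: the contrapositive of «a nonzero central `z ∈ Lie Hg ∩ End_Hdg` integrates to a one-parameter family in
the centre of `Hg`»). If the `Θ`-trace condition fails, §1 of the abstract file gives a nonzero SEMISIMPLE central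
`z ∈ Lie Hg(H¹A) ∩ End_Hdg(H¹A)`; its spectral exponentials `U_s = ∑_μ e^{sμ} P_μ` (`s ∈ ℂ`) on `H¹(A(ℂ); ℂ)` commute
with `End(A)` (a central Hodge endomorphism is `c · F^*`, `F` central in `End⁰(A)`, by Riemann's theorem
`exists_conj_baseChange_eq_smul_pullbackOne`), and `⋀•(U_s^{⊕(a+1)})` fixes every Hodge class of every power
(§3), so `⋀•U_s ∈ Hg(A)(ℂ)` (`exteriorPullbackEquiv_mem_hodgeGroup_of_forall`), central (an element of `Hg` is
determined by its action on `H¹`, where it commutes with `End(A)`, `hodgeGroup_ext_one`,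
`hodgeGroupOne_comm_pullbackOne`); `k ↦ ⋀•U_{k/μ₀}` (`μ₀ ≠ 0` an eigenvalue) is injective `ℕ → Z(Hg(A)(ℂ))`, so the
centre is infinite. This is the direction «`Hg(A)` semisimple ⟹ multiplicities balanced / no type-IV centre» of
Gordon 2.9 (Silverberg–Zarhin) and Moonen–Zarhin §1 Remark (1), on the tree's Tannaka-free carrier.
[cite: Gordon1999HodgeAVSurvey, 2.9 Proposition and 2.12] [cite: MoonenZarhin1998WeilClasses, §1 Lemma (1) and Remark (1)]
[cite: Deligne1982HodgeCycles, I §3 Prop. 3.4, 3.6] -/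
theorem hodgeThetaTraceCondition_of_hasSemisimpleHodgeGroup (A : AbelianVariety ℂ) (h : HasSemisimpleHodgeGroup A) :
    HodgeThetaTraceCondition A := by
  classical
  haveI hHT : HodgeTensorFacts.{0, 0} := hodgeTensorFacts_holds.{0, 0}
  by_contra hT
  have hXA : IsSmoothProjective A.dim A.X := AbelianVariety.isSmoothProjective_holds
  haveI : Module.Finite ℚ (bettiCohomology A.X 1) := finite_bettiCohomology_one A
  set HA := BettiUniverse.hodge exists_isReal_hodgeModel_holds hXA 1 with hHAdef
  have heff : HA.IsEffective := BettiUniverse.hodge_isEffective exists_isReal_hodgeModel_holds hXA 1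
  have hpol : HA.IsPolarizable :=
    smoothProjective_hodgeStructure_isPolarizable_holds hXA (BettiUniverse.realHodgeModel exists_isReal_hodgeModel_holds hXA)
      (BettiUniverse.realHodgeModel_isHodgeSymmetric exists_isReal_hodgeModel_holds hXA) 1
  have hn1 : ((1 : ℕ) : ℤ) = 1 := by norm_num
  -- (1) a nonzero semisimple central element `z ∈ Lie Hg ∩ End_Hdg`
  obtain ⟨z, hz𝔥, hzE, hz0, hzc, -, hss⟩ := exists_central_ne_zero_of_not_thetaTraceCondition HA hn1 heff hpol hT
  have hac : ∀ c ∈ HA.endAlg, z * c = c * z := fun c hc => hzc ⟨c, hc⟩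
  -- (2) a Hodge-adapted eigenbasis `b`, `z_ℂ b_m = μ_m b_m`
  obtain ⟨b, μ, κ, hzb, hb0, hb1⟩ := exists_eigenbasis_hodgeAdapted_hOne (A := A) hzE hss
  -- (3) a nonzero eigenvalue `μ_{m₀}` (`z ≠ 0`)
  have hμ : ∃ m₀, μ m₀ ≠ 0 := by
    by_contra hall
    push Not at hall
    apply hz0
    have hzC : z.baseChange ℂ = 0 :=
      b.ext fun m => by rw [hzb, hall m, zero_smul, LinearMap.zero_apply]
    refine LinearMap.ext fun x => ofRatClass_injective (Y := ComplexPoints A.X) 1 ?_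
    have h1 : z.baseChange ℂ ((1 : ℂ) ⊗ₜ[ℚ] x) = (1 : ℂ) ⊗ₜ[ℚ] z x := LinearMap.baseChange_tmul _ _ _
    rw [hzC, LinearMap.zero_apply] at h1
    have h2 := congrArg (ofRatClassBaseChange (ComplexPoints A.X) 1) h1
    rw [map_zero, ofRatClassBaseChange_tmul, one_smul] at h2
    rw [LinearMap.zero_apply, map_zero]
    exact h2.symm
  obtain ⟨m₀, hm₀⟩ := hμ
  -- (4) letters `v_m = β b_m` in `H¹(A(ℂ); ℂ)`; the transported `z_ℂ` is `diag(μ)` and commutes with `End(A)`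
  set β := ofRatClassBaseChangeEquiv hXA 1 with hβ
  set v : Module.Basis _ ℂ (complexBetti A.X 1) := b.map β with hv
  have hv_apply : ∀ m, v m = ofRatClassBaseChange (ComplexPoints A.X) 1 (b m) := fun m => by
    rw [hv, Module.Basis.map_apply, hβ, ofRatClassBaseChangeEquiv_apply]
  have hgz : ∀ m, β.conj (z.baseChange ℂ) (v m) = μ m • v m := fun m => by
    rw [hv, Module.Basis.map_apply, LinearEquiv.conj_apply_apply, LinearEquiv.symm_apply_apply, hzb, map_smul]
  -- (5) the spectral exponentials `U_s`, `U_s v_m = exp(s μ_m) v_m`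
  set e : ℂ → Fin (Module.finrank ℚ (bettiCohomology A.X 1)) → ℂ := fun s m => Complex.exp (s * μ m) with he
  have he_ne : ∀ s m, e s m ≠ 0 := fun s m => Complex.exp_ne_zero _
  set U : ℂ → (complexBetti A.X 1 ≃ₗ[ℂ] complexBetti A.X 1) := fun s =>
    v.equiv (v.unitsSMul fun m => Units.mk0 (e s m) (he_ne s m)) (Equiv.refl _) with hU
  have hUv : ∀ s m, U s (v m) = e s m • v m := fun s m => by
    rw [hU]
    dsimp only
    rw [Module.Basis.equiv_apply, Equiv.refl_apply, Module.Basis.unitsSMul_apply, Units.smul_def, Units.val_mk0]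
  have hf : ∀ (s : ℂ) {d : ℕ} (m : Fin d → Fin (Module.finrank ℚ (bettiCohomology A.X 1))),
      (∑ t, μ (m t)) = 0 → ∏ t, e s (m t) = 1 := by
    intro s d m hm
    show ∏ t, Complex.exp (s * μ (m t)) = 1
    rw [← Complex.exp_sum, ← Finset.mul_sum, hm, mul_zero, Complex.exp_zero]
  -- `U_s` commutes with whatever commutes with `z_ℂ` (it is a polynomial in `z_ℂ`)
  have hU_comm : ∀ (s : ℂ) (T : Module.End ℂ (complexBetti A.X 1)),
      T * β.conj (z.baseChange ℂ) = β.conj (z.baseChange ℂ) * T →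
        T * (U s : complexBetti A.X 1 →ₗ[ℂ] complexBetti A.X 1) = (U s : complexBetti A.X 1 →ₗ[ℂ] complexBetti A.X 1) * T := by
    intro s T hT
    refine comp_eq_comp_of_apply_basis_eq_smul v μ (e s) hgz (fun m m' hmm' => ?_) (fun m => ?_) hT
    · show Complex.exp (s * μ m) = Complex.exp (s * μ m')
      rw [hmm']
    · rw [LinearEquiv.coe_coe, hUv]
  -- (6) `U_s ∈ (C(A) ⊗ ℂ)^×`
  have hUC : ∀ s, U s ∈ centralizerGroup A := fun s => mem_centralizerGroup_iff.2 fun φ x => by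
    have h1 := LinearMap.congr_fun (hU_comm s (pullbackOne A φ) (conj_baseChange_comm_pullbackOne z hac φ)) x
    rw [Module.End.mul_apply, Module.End.mul_apply, LinearEquiv.coe_coe] at h1
    exact h1.symm
  -- (7) `⋀•(U_s^{⊕(a+1)})` fixes the Hodge classes of the powers, so `⋀•U_s ∈ Hg(A)(ℂ)`
  have key : ∀ (s : ℂ) (a p : ℕ) (c : complexBetti (A.powSucc a).X (2 * p)), IsRationalClass c →
      IsOfHodgeType (A.powSucc a).dim (A.powSucc a).X (2 * p) p p c → diagPowExterior A (U s) a (2 * p) c = c :=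
    fun s => diagPowExterior_apply_eq_self_of_eigenletters hz𝔥 b μ κ hzb hb0 hb1 (hUC s) (e s)
      (fun m => by rw [← hv_apply]; exact hUv s m) (fun m hm => hf s m hm)
  set G : ℂ → (∀ k : ℕ, complexBetti A.X k ≃ₗ[ℂ] complexBetti A.X k) := fun s k =>
    exteriorPullbackEquiv (AbelianVariety.hasExteriorCohomologyH1_complexPoints A) (U s) k with hGdef
  have hG : ∀ s, G s ∈ hodgeGroup A.dim A.X := fun s => exteriorPullbackEquiv_mem_hodgeGroup_of_forall (key s)
  have hG1 : ∀ s, G s 1 = U s := fun s => exteriorPullbackEquiv_one_eq _ _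
  -- (8) `⋀•U_s` is central in `Hg(A)(ℂ)`: compare on `H¹`, where `Hg` commutes with `End(A)` hence with `z_ℂ = c F^*`
  obtain ⟨c, F, hcF⟩ := exists_conj_baseChange_eq_smul_pullbackOne z hzE
  have hcent : ∀ s, (⟨G s, hG s⟩ : hodgeGroup A.dim A.X) ∈ Subgroup.center (hodgeGroup A.dim A.X) := by
    intro s
    rw [Subgroup.mem_center_iff]
    intro g
    apply Subtype.ext
    refine hodgeGroup_ext_one (mul_mem g.2 (hG s)) (mul_mem (hG s) g.2) ?_
    show g.1 1 * G s 1 = G s 1 * g.1 1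
    rw [hG1]
    have hg1 : g.1 1 ∈ hodgeGroupOne A.dim A.X := mem_hodgeGroupOne_iff.2 ⟨g.1, g.2, rfl⟩
    have hT : (g.1 1 : Module.End ℂ (complexBetti A.X 1)) * β.conj (z.baseChange ℂ) =
        β.conj (z.baseChange ℂ) * (g.1 1 : Module.End ℂ (complexBetti A.X 1)) := by
      rw [hcF]
      refine LinearMap.ext fun x => ?_
      rw [Module.End.mul_apply, Module.End.mul_apply, LinearMap.smul_apply, LinearMap.smul_apply, LinearEquiv.coe_coe,
        map_smul, hodgeGroupOne_comm_pullbackOne hg1]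
    refine LinearEquiv.toLinearMap_injective ?_
    rw [LinearEquiv.coe_toLinearMap_mul, LinearEquiv.coe_toLinearMap_mul]
    exact hU_comm s _ hT
  -- (9) `k ↦ ⋀•U_{k/μ₀}` is injective `ℕ → Z(Hg(A)(ℂ))`: the centre is infinite
  let Φ : ℕ → Subgroup.center (hodgeGroup A.dim A.X) := fun k => ⟨⟨G ((k : ℂ) / μ m₀), hG _⟩, hcent _⟩
  have hΦ : Function.Injective Φ := by
    intro k k' hkk'
    have h1 : G ((k : ℂ) / μ m₀) = G ((k' : ℂ) / μ m₀) := congrArg (fun x : Subgroup.center (hodgeGroup A.dim A.X) => x.1.1) hkk'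
    have h2 := congrFun h1 1
    rw [hG1, hG1] at h2
    have h3 := LinearEquiv.congr_fun h2 (v m₀)
    rw [hUv, hUv] at h3
    have h4 : e ((k : ℂ) / μ m₀) m₀ = e ((k' : ℂ) / μ m₀) m₀ := smul_left_injective ℂ (v.ne_zero m₀) h3
    have h5 : Complex.exp ((k : ℂ) / μ m₀ * μ m₀) = Complex.exp ((k' : ℂ) / μ m₀ * μ m₀) := h4
    rw [div_mul_cancel₀ _ hm₀, div_mul_cancel₀ _ hm₀, ← Complex.ofReal_natCast k, ← Complex.ofReal_natCast k',
      ← Complex.ofReal_exp, ← Complex.ofReal_exp] at h5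
    exact_mod_cast Real.exp_eq_exp.1 (Complex.ofReal_injective h5)
  haveI : Finite (Subgroup.center (hodgeGroup A.dim A.X)) := h
  haveI : Finite ℕ := Finite.of_injective Φ hΦ
  exact not_finite ℕ

/-- **GORDON'S PRODUCT FACT, DISCHARGED**: for complex abelian varieties `A` with semisimple Hodge group
(finite centre of `Hg(A)(ℂ)`) and `C` of CM type, the rational Hodge classes of `A × C` are spanned by exterior
products of Hodge classes of the factors — `Gordon1999_hodgeClassesProductSpan_of_semisimple` AS TYPED, now a
theorem: finite centre ⟹ `Θ`-trace condition (above) ⟹ product span (`hodgeClassesProductSpan_of_thetaTrace_of_isOfCMType`,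
Moonen–Zarhin (3.1) by the tree's infinitesimal invariant theory). (The `_holds` lives here and not next to
the `def` because the proof imports the product-span file, which imports the fact's file.)
[cite: Gordon1999HodgeAVSurvey, §3 proof of the Theorem (last step), 2.16 Proposition (1), 2.12 Proposition]
[cite: MoonenZarhin1999LowDim, §3 (3.1)] -/
theorem Gordon1999_hodgeClassesProductSpan_of_semisimple_holds : Gordon1999_hodgeClassesProductSpan_of_semisimple :=
  fun A _ hA hC => hodgeClassesProductSpan_of_thetaTrace_of_isOfCMType (hodgeThetaTraceCondition_of_hasSemisimpleHodgeGroup A hA) hC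

/-- **Binder-free**: `Hg(A)` semisimple, `C` of CM type ⟹ `HodgeClassesProductSpan A C`.
[cite: Gordon1999HodgeAVSurvey, §3 proof of the Theorem (last step)] [cite: MoonenZarhin1999LowDim, §3 (3.1)] -/
theorem hodgeClassesProductSpan_of_hasSemisimpleHodgeGroup_of_isOfCMType {A C : AbelianVariety ℂ}
    (hA : HasSemisimpleHodgeGroup A) (hC : Milne1999.IsOfCMType C) : HodgeClassesProductSpan A C :=
  Gordon1999_hodgeClassesProductSpan_of_semisimple_holds A C hA hC

/-- **Binder-free exactness on Gordon's class**: for `A` with semisimple Hodge group and `C` of CM type,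
HC(`A × C`) ⟺ HC(`A`) ∧ HC(`C`) (`hodgeConjectureFor_prod_iff_of_gordon` fed with the discharged fact).
[cite: Gordon1999HodgeAVSurvey, §3 proof of the Theorem (last step)] [cite: Fulton1998, §19.2] -/
theorem hodgeConjectureFor_prod_iff_of_hasSemisimpleHodgeGroup (A C : AbelianVariety ℂ)
    (hA : HasSemisimpleHodgeGroup A) (hCt : Milne1999.IsOfCMType C) :
    HodgeConjectureFor (A.prod C).dim (A.prod C).X ↔ HodgeConjectureFor A.dim A.X ∧ HodgeConjectureFor C.dim C.X :=
  hodgeConjectureFor_prod_iff_of_gordon Gordon1999_hodgeClassesProductSpan_of_semisimple_holds A C hA hCt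

/-- **Binder-free slice equivalence**: for ONE `A₀` with semisimple Hodge group satisfying HC, «HC for every
`A₀ × C`, `C` of CM type» ⟺ HC_CM (`forall_prod_cmType_iff_cmHodgeHypothesis_of_semisimple` fed with the
discharged fact; HONEST FRAMING: research route conditional on HC_CM; not a corollary; Q11.4-sentence-2 already
refuted in dim ≥ 3). [cite: Gordon1999HodgeAVSurvey, §3 proof of the Theorem (last step)] [cite: Milne1999, §7 (H)] -/
theorem forall_prod_cmType_iff_cmHodgeHypothesis_of_hasSemisimpleHodgeGroup (A₀ : AbelianVariety ℂ)
    (h₀ : HasSemisimpleHodgeGroup A₀) (hH₀ : HodgeConjectureFor A₀.dim A₀.X) :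
    (∀ C : AbelianVariety ℂ, Milne1999.IsOfCMType C → HodgeConjectureFor (A₀.prod C).dim (A₀.prod C).X) ↔
      ∀ C : AbelianVariety ℂ, Milne1999.CMHodgeHypothesisAt C :=
  forall_prod_cmType_iff_cmHodgeHypothesis_of_semisimple Gordon1999_hodgeClassesProductSpan_of_semisimple_holds A₀ h₀ hH₀

end Main

/-! ### §5 Conversely: the `Θ`-trace condition balances EVERY subfield `ℚ(φ) ⊆ End⁰(A)`; Gordon 2.9 as an equivalence when the centre lies in `ℚ(φ)` -/

section Converse

open Polynomial

variable {A : AbelianVariety ℂ}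

/-- Conjugation by a linear equivalence commutes with powers. [folklore] -/
private theorem conj_pow' {M M₂ : Type*} [AddCommGroup M] [Module ℂ M] [AddCommGroup M₂] [Module ℂ M₂]
    (e : M ≃ₗ[ℂ] M₂) (x : Module.End ℂ M) (j : ℕ) : e.conj (x ^ j) = (e.conj x) ^ j := by
  induction j with
  | zero => rw [pow_zero, pow_zero, Module.End.one_eq_id, LinearEquiv.conj_id, Module.End.one_eq_id]
  | succ j ih => rw [pow_succ, pow_succ, Module.End.mul_eq_comp, LinearEquiv.conj_comp, ih, ← Module.End.mul_eq_comp]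

/-- **The `Θ`-trace condition balances the multiplicities of EVERY `φ ∈ End(A)` generating a field** («`Hdg(X)` semi-simple
⟹ `Hdg(X) ⊂ Sl_F(V_X)` ⟹ `W_F` consists of Hodge classes ⟹ `n_σ = n_{σ'}` for all `σ ∈ Σ_F`», Moonen–Zarhin; here from
the Lie algebra: under the `Θ`-trace condition `tr(Θ ∘ q(φ^*)) = 0` for every complex polynomial `q`
(`trace_mul_aeval_baseChange_eq_zero_of_thetaTraceCondition`), while on `H¹(A(ℂ); ℂ) = ⊕_ρ V_ρ` one computes
`tr(Θ ∘ q(φ^*)) = ∑_ρ q(ρ) (n_ρ - n_ρ̄)` (`Θ = ±1` on `H^{1,0}`, `H^{0,1}`; `n'_ρ = dim V_ρ^{0,1} = n_ρ̄`); a polynomial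
vanishing at the other roots singles out `n_ρ = n_ρ̄`). No centrality of `φ` is needed.
[cite: MoonenZarhin1998WeilClasses, §1 Criterion and Remark (1) after Criterion (2)] [cite: Deligne1982HodgeCycles, I §4 Prop. 4.4 and its proof] -/
theorem eigenMultiplicity_eq_of_hodgeThetaTraceCondition (hT : HodgeThetaTraceCondition A) {φ : A ⟶ A} {P : Polynomial ℤ}
    (hPm : P.Monic) (hPirr : Irreducible (P.map (Int.castRingHom ℚ)))
    (hφ : Polynomial.eval₂ (Int.castRingHom (CategoryTheory.End A)) (φ : CategoryTheory.End A) P = 0)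
    {ρ : ℂ} (hρ : Polynomial.eval₂ (Int.castRingHom ℂ) ρ P = 0) :
    eigenMultiplicity A φ ρ = eigenMultiplicity A φ (starRingEnd ℂ ρ) := by
  classical
  haveI hHT : HodgeTensorFacts.{0, 0} := hodgeTensorFacts_holds.{0, 0}
  have hXA : IsSmoothProjective A.dim A.X := AbelianVariety.isSmoothProjective_holds
  haveI := finite_complexBetti_abelianVariety A 1
  haveI : Module.Finite ℚ (bettiCohomology A.X 1) := finite_bettiCohomology_one A
  set HA := BettiUniverse.hodge exists_isReal_hodgeModel_holds hXA 1 with hHAdef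
  have heff : HA.IsEffective := BettiUniverse.hodge_isEffective exists_isReal_hodgeModel_holds hXA 1
  have hpol : HA.IsPolarizable :=
    smoothProjective_hodgeStructure_isPolarizable_holds hXA (BettiUniverse.realHodgeModel exists_isReal_hodgeModel_holds hXA)
      (BettiUniverse.realHodgeModel_isHodgeSymmetric exists_isReal_hodgeModel_holds hXA) 1
  have hn1 : ((1 : ℕ) : ℤ) = 1 := by norm_num
  obtain ⟨Θ, hΘ⟩ := exists_hodgeTheta HA
  set β := ofRatClassBaseChangeEquiv hXA 1 with hβdef
  -- the rational Hodge endomorphism `a = φ^*` and its transport `F = φ^*` to `H¹(A(ℂ); ℂ)`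
  set a : Module.End ℚ (bettiCohomology A.X 1) := BettiUniverse.pull φ.hom.hom.hom 1 with hadef
  have ha : a ∈ HA.endAlg := by
    have h := unop_bettiRep_mem_endAlg exists_isReal_hodgeModel_holds hodgePQ_independent_of_hodgeModel_holds
      (AbelianVariety.endAlgebra.of A φ)
    rwa [bettiRep_of, MulOpposite.unop_op] at h
  set F : Module.End ℂ (complexBetti A.X 1) := pullbackOne A φ with hFdef
  have hβa : β.conj (a.baseChange ℂ) = F := conj_baseChange_pull_eq_pullbackOne φ
  set T : Module.End ℂ (complexBetti A.X 1) := β.conj Θ with hTdef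
  -- (1) `tr(T ∘ q(F)) = 0` for every complex polynomial `q` (transport of §4 of the abstract file)
  have hconj : ∀ q : ℂ[X], β.conj (aeval (a.baseChange ℂ) q) = aeval F q := by
    intro q
    induction q using Polynomial.induction_on' with
    | add p q hp hq => rw [map_add, map_add, hp, hq, map_add]
    | monomial k c =>
      rw [aeval_monomial, aeval_monomial, Algebra.algebraMap_eq_smul_one, Algebra.algebraMap_eq_smul_one, smul_mul_assoc,
        smul_mul_assoc, one_mul, one_mul, map_smul, conj_pow', hβa]
  have htrq : ∀ q : ℂ[X], LinearMap.trace ℂ _ (T * aeval F q) = 0 := by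
    intro q
    have h1 := trace_mul_aeval_baseChange_eq_zero_of_thetaTraceCondition HA hn1 heff hpol hT hΘ ha q
    rw [← LinearMap.trace_conj' (Θ * aeval (a.baseChange ℂ) q) β, Module.End.mul_eq_comp, LinearEquiv.conj_comp,
      ← Module.End.mul_eq_comp, hconj] at h1
    exact h1
  -- (2) `F = φ^*` is semisimple: `H¹ = ⊕_{P(ρ') = 0} V_ρ'`
  have hP0 : P ≠ 0 := hPm.ne_zero
  have hsepC : (P.map (Int.castRingHom ℂ)).Separable := by
    rw [map_castRingHom_complex_eq]; exact hPirr.separable.map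
  have hF0 : aeval F (P.map (Int.castRingHom ℂ)) = 0 := aeval_hom_complexBetti_map_one_eq_zero hφ
  have hss : F.IsSemisimple := Module.End.isSemisimple_of_squarefree_aeval_eq_zero hsepC.squarefree hF0
  have htop : ⨆ μ, F.eigenspace μ = ⊤ := hss.iSup_eigenspace_eq_top
  have hroot : ∀ μ, F.eigenspace μ ≠ ⊥ → Polynomial.eval₂ (Int.castRingHom ℂ) μ P = 0 := by
    intro μ hμ
    obtain ⟨v, hv, hv0⟩ := (Submodule.ne_bot_iff _).1 hμ
    have h := Module.End.aeval_apply_of_hasEigenvector (f := F) (p := P.map (Int.castRingHom ℂ))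
      (Module.End.hasEigenvector_iff.2 ⟨hv, hv0⟩)
    rw [hF0, LinearMap.zero_apply, Polynomial.eval_map] at h
    exact (smul_eq_zero.1 h.symm).resolve_right hv0
  let Z : Finset ℂ := (P.map (Int.castRingHom ℂ)).roots.toFinset
  have hZ : ∀ μ, μ ∈ Z ↔ Polynomial.eval₂ (Int.castRingHom ℂ) μ P = 0 := mem_roots_toFinset_map_iff hP0
  have hρZ : ρ ∈ Z := (hZ ρ).2 hρ
  let V : Z → Submodule ℂ (complexBetti A.X 1) := fun ρ' => F.eigenspace (ρ' : ℂ)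
  have hind : iSupIndep V := (Module.End.eigenspaces_iSupIndep F).comp Subtype.val_injective
  have hsup : iSup V = ⊤ := by
    refine le_antisymm le_top ?_
    rw [← htop]
    refine iSup_le fun μ => ?_
    by_cases hμ : F.eigenspace μ = ⊥
    · rw [hμ]; exact bot_le
    · exact le_iSup V ⟨μ, (hZ μ).2 (hroot μ hμ)⟩
  have hint : DirectSum.IsInternal V := DirectSum.isInternal_submodule_of_iSupIndep_of_iSup_eq_top hind hsup
  -- the test polynomial: `q(ρ) = 1`, `q(ρ') = 0` at the other roots; `g = q(F)` acts on `V_ρ'` by `q(ρ')`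
  set q : ℂ[X] := Lagrange.basis Z id ρ with hqdef
  have hqρ : q.eval ρ = 1 := by
    have h := Lagrange.eval_basis_self (v := id) (Set.injOn_id _) hρZ
    exact h
  have hqne : ∀ ρ' ∈ Z, ρ' ≠ ρ → q.eval ρ' = 0 := by
    intro ρ' hρ' hne
    have h := Lagrange.eval_basis_of_ne (v := id) (Ne.symm hne) hρ'
    exact h
  set g : Module.End ℂ (complexBetti A.X 1) := aeval F q with hgdef
  have hgV : ∀ (ρ' : ℂ), ∀ v ∈ F.eigenspace ρ', g v = q.eval ρ' • v := by
    intro ρ' v hv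
    by_cases hv0 : v = 0
    · rw [hv0, map_zero, smul_zero]
    · exact Module.End.aeval_apply_of_hasEigenvector (Module.End.hasEigenvector_iff.2 ⟨hv, hv0⟩)
  -- (3) `T = β Θ β⁻¹ = ± 1` on `H^{1,0}`, `H^{0,1}`; it preserves each `V_ρ'`
  have hβ10 : ∀ y, y ∈ (BettiUniverse.hodge exists_isReal_hodgeModel_holds hXA 1).piece ((1 : ℕ) : ℤ) ((0 : ℕ) : ℤ) ↔
      β y ∈ hodgeOneZero hXA := fun y =>
    (BettiUniverse.mem_hodge_piece_iff exists_isReal_hodgeModel_holds hodgePQ_independent_of_hodgeModel_holds hXA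
      (k := 1) (p := 1) (q := 0) rfl y).trans (mem_hodgeOneZero hXA).symm
  have hβ01 : ∀ y, y ∈ (BettiUniverse.hodge exists_isReal_hodgeModel_holds hXA 1).piece ((0 : ℕ) : ℤ) ((1 : ℕ) : ℤ) ↔
      β y ∈ hodgeZeroOne hXA := fun y =>
    (BettiUniverse.mem_hodge_piece_iff exists_isReal_hodgeModel_holds hodgePQ_independent_of_hodgeModel_holds hXA
      (k := 1) (p := 0) (q := 1) rfl y).trans (mem_hodgeZeroOne hXA).symm
  have hT10 : ∀ x ∈ hodgeOneZero hXA, T x = x := by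
    intro x hx
    have hy : β.symm x ∈ (BettiUniverse.hodge exists_isReal_hodgeModel_holds hXA 1).piece 1 (((1 : ℕ) : ℤ) - 1) := by
      have h := (hβ10 (β.symm x)).2 (by rw [LinearEquiv.apply_symm_apply]; exact hx)
      simpa using h
    have h := hΘ 1 (β.symm x) hy
    rw [hTdef, LinearEquiv.conj_apply_apply, h, map_smul, LinearEquiv.apply_symm_apply]
    norm_num
  have hT01 : ∀ x ∈ hodgeZeroOne hXA, T x = -x := by
    intro x hx
    have hy : β.symm x ∈ (BettiUniverse.hodge exists_isReal_hodgeModel_holds hXA 1).piece 0 (((1 : ℕ) : ℤ) - 0) := by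
      have h := (hβ01 (β.symm x)).2 (by rw [LinearEquiv.apply_symm_apply]; exact hx)
      simpa using h
    have h := hΘ 0 (β.symm x) hy
    rw [hTdef, LinearEquiv.conj_apply_apply, h, map_smul, LinearEquiv.apply_symm_apply]
    norm_num [neg_one_smul]
  have hTV : ∀ ρ' : ℂ, ∀ v ∈ F.eigenspace ρ', T v ∈ F.eigenspace ρ' := by
    intro ρ' v hv
    have hv' : v ∈ F.eigenspace ρ' ⊓ hodgeOneZero hXA ⊔ F.eigenspace ρ' ⊓ hodgeZeroOne hXA := by
      rw [hFdef, ← eigenspace_eq_sup hXA φ.hom.hom.hom ρ']; exact hv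
    obtain ⟨y, hy, z, hz, rfl⟩ := Submodule.mem_sup.1 hv'
    rw [map_add, hT10 _ (Submodule.mem_inf.1 hy).2, hT01 _ (Submodule.mem_inf.1 hz).2]
    exact Submodule.add_mem _ (Submodule.mem_inf.1 hy).1 (Submodule.neg_mem _ (Submodule.mem_inf.1 hz).1)
  -- (4) `0 = tr(T q(F)) = Σ_ρ' q(ρ') · (n_ρ' - n_ρ̄') = n_ρ - n_ρ̄`
  have hmaps : ∀ ρ' : Z, Set.MapsTo (T * g) (V ρ') (V ρ') := by
    intro ρ' v hv
    simp only [SetLike.mem_coe] at hv ⊢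
    rw [Module.End.mul_apply, hgV _ v hv, map_smul]
    exact Submodule.smul_mem _ _ (hTV _ v hv)
  have htr_block : ∀ ρ' : Z, LinearMap.trace ℂ (V ρ') ((T * g).restrict (hmaps ρ')) =
      q.eval (ρ' : ℂ) * ((eigenMultiplicity A φ ρ' : ℂ) - eigenMultiplicity A φ (starRingEnd ℂ ρ')) := by
    intro ρ'
    have hTmaps : Set.MapsTo T (V ρ') (V ρ') := fun v hv => hTV _ v hv
    have hres : (T * g).restrict (hmaps ρ') = (q.eval (ρ' : ℂ)) • T.restrict hTmaps := by
      refine LinearMap.ext fun v => Subtype.ext ?_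
      simp only [LinearMap.smul_apply, Submodule.coe_smul, LinearMap.coe_restrict_apply, Module.End.mul_apply]
      rw [hgV _ _ v.2, map_smul]
    -- `tr(T|V_ρ') = n_ρ' - n'_ρ'` with `n'_ρ' = n_ρ̄'`
    have htr : LinearMap.trace ℂ (V ρ') (T.restrict hTmaps) =
        (eigenMultiplicity A φ ρ' : ℂ) - eigenMultiplicity A φ (starRingEnd ℂ ρ') := by
      let N : Bool → Submodule ℂ (V ρ') := fun b =>
        cond b (Submodule.comap (V ρ').subtype (V ρ' ⊓ hodgeOneZero hXA)) (Submodule.comap (V ρ').subtype (V ρ' ⊓ hodgeZeroOne hXA))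
      have hNt_mem : ∀ x : V ρ', x ∈ N true ↔ (x : complexBetti A.X 1) ∈ hodgeOneZero hXA := fun x => by
        simp only [N, cond_true, Submodule.mem_comap, Submodule.subtype_apply, Submodule.mem_inf]
        exact ⟨fun h => h.2, fun h => ⟨x.2, h⟩⟩
      have hNf_mem : ∀ x : V ρ', x ∈ N false ↔ (x : complexBetti A.X 1) ∈ hodgeZeroOne hXA := fun x => by
        simp only [N, cond_false, Submodule.mem_comap, Submodule.subtype_apply, Submodule.mem_inf]
        exact ⟨fun h => h.2, fun h => ⟨x.2, h⟩⟩
      have hNint : DirectSum.IsInternal N := by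
        refine (DirectSum.isInternal_submodule_iff_isCompl N (i := true) (j := false) (by decide) ?_).2 ⟨?_, ?_⟩
        · ext b; cases b <;> simp
        · rw [Submodule.disjoint_def]
          intro x hx1 hx2
          have h : (x : complexBetti A.X 1) ∈ hodgeOneZero hXA ⊓ hodgeZeroOne hXA :=
            Submodule.mem_inf.2 ⟨(hNt_mem x).1 hx1, (hNf_mem x).1 hx2⟩
          rw [hodgeOneZero_inf_hodgeZeroOne, Submodule.mem_bot] at h
          exact_mod_cast h
        · rw [codisjoint_iff, Submodule.eq_top_iff']
          intro x
          have hx : (x : complexBetti A.X 1) ∈ F.eigenspace ρ' ⊓ hodgeOneZero hXA ⊔ F.eigenspace ρ' ⊓ hodgeZeroOne hXA := by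
            rw [hFdef, ← eigenspace_eq_sup hXA φ.hom.hom.hom ρ']; exact x.2
          obtain ⟨y, hy, z, hz, hyz⟩ := Submodule.mem_sup.1 hx
          rw [Submodule.mem_sup]
          refine ⟨⟨y, (Submodule.mem_inf.1 hy).1⟩, (hNt_mem _).2 (Submodule.mem_inf.1 hy).2,
            ⟨z, (Submodule.mem_inf.1 hz).1⟩, (hNf_mem _).2 (Submodule.mem_inf.1 hz).2, Subtype.ext ?_⟩
          simpa using hyz
      have hNmaps : ∀ b, Set.MapsTo (T.restrict hTmaps) (N b) (N b) := by
        intro b x hx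
        simp only [SetLike.mem_coe] at hx ⊢
        cases b with
        | false =>
          rw [hNf_mem] at hx ⊢
          rw [LinearMap.coe_restrict_apply, hT01 _ hx]
          exact Submodule.neg_mem _ hx
        | true =>
          rw [hNt_mem] at hx ⊢
          rw [LinearMap.coe_restrict_apply, hT10 _ hx]
          exact hx
      have hNt : (T.restrict hTmaps).restrict (hNmaps true) = LinearMap.id := by
        refine LinearMap.ext fun x => Subtype.ext (Subtype.ext ?_)
        simp only [LinearMap.coe_restrict_apply, LinearMap.id_coe, id_eq]
        exact hT10 _ ((hNt_mem _).1 x.2)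
      have hNf : (T.restrict hTmaps).restrict (hNmaps false) = -LinearMap.id := by
        refine LinearMap.ext fun x => Subtype.ext (Subtype.ext ?_)
        simp only [LinearMap.coe_restrict_apply, LinearMap.neg_apply, LinearMap.id_coe, id_eq, Submodule.coe_neg]
        exact hT01 _ ((hNf_mem _).1 x.2)
      have h1 : Module.finrank ℂ (N true) = eigenMultiplicity A φ ρ' := by
        change Module.finrank ℂ (Submodule.comap (V ρ').subtype (V ρ' ⊓ hodgeOneZero hXA)) = _
        rw [LinearEquiv.finrank_eq (Submodule.comapSubtypeEquivOfLe inf_le_left)]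
        rfl
      have h2 : Module.finrank ℂ (N false) = eigenMultiplicity A φ (starRingEnd ℂ ρ') := by
        change Module.finrank ℂ (Submodule.comap (V ρ').subtype (V ρ' ⊓ hodgeZeroOne hXA)) = _
        rw [LinearEquiv.finrank_eq (Submodule.comapSubtypeEquivOfLe inf_le_left)]
        have h := finrank_eigenspace_inf_hodgeZeroOne_eq hXA φ.hom.hom.hom (starRingEnd ℂ (ρ' : ℂ))
        rw [Complex.conj_conj] at h
        exact h
      have htt : LinearMap.trace ℂ (N true) ((T.restrict hTmaps).restrict (hNmaps true)) = (Module.finrank ℂ (N true) : ℂ) := by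
        rw [hNt, LinearMap.trace_id]
      have htf : LinearMap.trace ℂ (N false) ((T.restrict hTmaps).restrict (hNmaps false)) =
          -(Module.finrank ℂ (N false) : ℂ) := by
        rw [hNf]
        exact (map_neg (LinearMap.trace ℂ (N false)) (LinearMap.id : N false →ₗ[ℂ] N false)).trans
          (by rw [LinearMap.trace_id])
      rw [LinearMap.trace_eq_sum_trace_restrict hNint hNmaps, Fintype.sum_bool, htt, htf, h1, h2, sub_eq_add_neg]
    rw [hres, map_smul, htr, smul_eq_mul]
  have hsum : LinearMap.trace ℂ _ (T * g) = (eigenMultiplicity A φ ρ : ℂ) - eigenMultiplicity A φ (starRingEnd ℂ ρ) := by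
    rw [LinearMap.trace_eq_sum_trace_restrict hint hmaps, Finset.sum_eq_single (⟨ρ, hρZ⟩ : Z)]
    · rw [htr_block, hqρ, one_mul]
    · intro b _ hb
      rw [htr_block, hqne b b.2 (fun h => hb (Subtype.ext h)), zero_mul]
    · intro h; exact absurd (Finset.mem_univ _) h
  have h0 : LinearMap.trace ℂ _ (T * g) = 0 := htrq q
  rw [hsum, sub_eq_zero] at h0
  exact_mod_cast h0

/-- **`Hg(A)(ℂ)` with finite centre ⟹ the Weil classes of every `F = ℚ(φ) ⊆ End⁰(A)` are Hodge classes** («If `X` has no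
factors of type 4 then the Hodge group `Hdg(X)` is semi-simple, hence contained in `Sl_F(V_X)`, which means that `W_F`
consists of Hodge classes» — Moonen–Zarhin, here for any `A` with semisimple Hodge group): finite centre ⟹ `Θ`-trace
condition (§4) ⟹ balanced multiplicities (above) ⟹ `W_F ≤ Bᵖ ⊗ ℂ` (Deligne's / Moonen–Zarhin's criterion,
`Deligne1982.weilClassesField_le_hodgeClassSpan_iff_forall_eigenMultiplicity_eq`).
[cite: MoonenZarhin1998WeilClasses, §1 Criterion and Remark (1) after Criterion (2)] [cite: Deligne1982HodgeCycles, I §4 Prop. 4.4] -/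
theorem weilClassesField_le_hodgeClassSpan_of_hodgeThetaTraceCondition (hT : HodgeThetaTraceCondition A) {φ : A ⟶ A}
    {P : Polynomial ℤ} {e p : ℕ} (hPm : P.Monic) (hPe : P.natDegree = e) (hPirr : Irreducible (P.map (Int.castRingHom ℚ)))
    (hφ : Polynomial.eval₂ (Int.castRingHom (CategoryTheory.End A)) (φ : CategoryTheory.End A) P = 0)
    (her : e * (2 * p) = 2 * A.dim) : weilClassesField A φ P (2 * p) ≤ hodgeClassSpan A.dim A.X p :=
  (Deligne1982.weilClassesField_le_hodgeClassSpan_iff_forall_eigenMultiplicity_eq hPm hPe hPirr hφ her).2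
    fun _ hρ => eigenMultiplicity_eq_of_hodgeThetaTraceCondition hT hPm hPirr hφ hρ

/-- **Semisimple Hodge group ⟹ `W_F` Hodge for every `F = ℚ(φ)`** (Moonen–Zarhin §1 Remark; Deligne 4.4), on the
Tannaka-free carrier: `HasSemisimpleHodgeGroup A ⟹ weilClassesField A φ P (2p) ≤ Bᵖ(A) ⊗ ℂ`.
[cite: MoonenZarhin1998WeilClasses, §1 Remark (1) after Criterion (2)] [cite: Deligne1982HodgeCycles, I §4 Prop. 4.4] -/
theorem weilClassesField_le_hodgeClassSpan_of_hasSemisimpleHodgeGroup (hA : HasSemisimpleHodgeGroup A) {φ : A ⟶ A}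
    {P : Polynomial ℤ} {e p : ℕ} (hPm : P.Monic) (hPe : P.natDegree = e) (hPirr : Irreducible (P.map (Int.castRingHom ℚ)))
    (hφ : Polynomial.eval₂ (Int.castRingHom (CategoryTheory.End A)) (φ : CategoryTheory.End A) P = 0)
    (her : e * (2 * p) = 2 * A.dim) : weilClassesField A φ P (2 * p) ≤ hodgeClassSpan A.dim A.X p :=
  weilClassesField_le_hodgeClassSpan_of_hodgeThetaTraceCondition (hodgeThetaTraceCondition_of_hasSemisimpleHodgeGroup A hA)
    hPm hPe hPirr hφ her

/-- **Semisimple Hodge group ⟹ balanced multiplicities `n_ρ = n_ρ̄` for every `φ ∈ End(A)` generating a field**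
(Gordon 2.9 / Silverberg–Zarhin, direction ⟹, for every subfield, on the carrier).
[cite: Gordon1999HodgeAVSurvey, 2.9 Proposition] [cite: MoonenZarhin1998WeilClasses, §1 Criterion and Remark (1) after Criterion (2)] -/
theorem eigenMultiplicity_eq_of_hasSemisimpleHodgeGroup (hA : HasSemisimpleHodgeGroup A) {φ : A ⟶ A} {P : Polynomial ℤ}
    (hPm : P.Monic) (hPirr : Irreducible (P.map (Int.castRingHom ℚ)))
    (hφ : Polynomial.eval₂ (Int.castRingHom (CategoryTheory.End A)) (φ : CategoryTheory.End A) P = 0)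
    {ρ : ℂ} (hρ : Polynomial.eval₂ (Int.castRingHom ℂ) ρ P = 0) :
    eigenMultiplicity A φ ρ = eigenMultiplicity A φ (starRingEnd ℂ ρ) :=
  eigenMultiplicity_eq_of_hodgeThetaTraceCondition (hodgeThetaTraceCondition_of_hasSemisimpleHodgeGroup A hA) hPm hPirr hφ hρ

/-- **The `Θ`-trace condition ⟹ finite centre, when the centre of `End⁰(A)` lies in the field `ℚ(φ)`** (every central
pull-back a polynomial in `φ^*`, `e · 2m = 2 dim A`): the other half of Gordon 2.9 on the carrier, by the balanced
multiplicities above and the tree's `hasSemisimpleHodgeGroup_of_forall_eigenMultiplicity_eq` («in all other cases it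
[the centre] is finite»). [cite: Gordon1999HodgeAVSurvey, 2.9 Proposition]
[cite: MoonenZarhin1998WeilClasses, §1 Lemma (1) and Remark (1) after Criterion (2)] -/
theorem hasSemisimpleHodgeGroup_of_hodgeThetaTraceCondition (hT : HodgeThetaTraceCondition A) {φ : A ⟶ A}
    {P : Polynomial ℤ} {e m : ℕ} (hPm : P.Monic) (hPe : P.natDegree = e) (hPirr : Irreducible (P.map (Int.castRingHom ℚ)))
    (hφ : Polynomial.eval₂ (Int.castRingHom (CategoryTheory.End A)) (φ : CategoryTheory.End A) P = 0)
    (her : e * (2 * m) = 2 * A.dim) (hm : m ≠ 0)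
    (hE : ∀ u : A ⟶ A, pullbackOne A u ∈ centralizerAlgebra A → pullbackOne A u ∈ Algebra.adjoin ℂ {pullbackOne A φ}) :
    HasSemisimpleHodgeGroup A :=
  hasSemisimpleHodgeGroup_of_forall_eigenMultiplicity_eq hPm hPe hPirr hφ her hm hE
    fun _ hρ => eigenMultiplicity_eq_of_hodgeThetaTraceCondition hT hPm hPirr hφ hρ

/-- **GORDON 2.9 ON THE CARRIER, AS AN EQUIVALENCE** for complex abelian varieties whose centre `Z(End⁰(A))` lies in a
field `ℚ(φ) ⊆ End⁰(A)` (e.g. `A` simple or isotypic with `φ` generating the centre, or any `A` of Weil type for `ℚ(φ)`):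
`Hg(A)(ℂ)` has finite centre ⟺ the `Θ`-trace condition ⟺ (by the previous results) the multiplicities of `φ` are
balanced ⟺ `W_{ℚ(φ)}` consists of Hodge classes. [cite: Gordon1999HodgeAVSurvey, 2.9 Proposition]
[cite: MoonenZarhin1998WeilClasses, §1 Criterion, Lemma (1) and Remark (1) after Criterion (2)] -/
theorem hasSemisimpleHodgeGroup_iff_hodgeThetaTraceCondition {φ : A ⟶ A} {P : Polynomial ℤ} {e m : ℕ} (hPm : P.Monic)
    (hPe : P.natDegree = e) (hPirr : Irreducible (P.map (Int.castRingHom ℚ)))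
    (hφ : Polynomial.eval₂ (Int.castRingHom (CategoryTheory.End A)) (φ : CategoryTheory.End A) P = 0)
    (her : e * (2 * m) = 2 * A.dim) (hm : m ≠ 0)
    (hE : ∀ u : A ⟶ A, pullbackOne A u ∈ centralizerAlgebra A → pullbackOne A u ∈ Algebra.adjoin ℂ {pullbackOne A φ}) :
    HasSemisimpleHodgeGroup A ↔ HodgeThetaTraceCondition A :=
  ⟨hodgeThetaTraceCondition_of_hasSemisimpleHodgeGroup A,
    fun hT => hasSemisimpleHodgeGroup_of_hodgeThetaTraceCondition hT hPm hPe hPirr hφ her hm hE⟩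

/-- **… and `Hg(A)(ℂ)` has finite centre ⟺ the multiplicities of `φ` are balanced** (same hypotheses).
[cite: Gordon1999HodgeAVSurvey, 2.9 Proposition] [cite: MoonenZarhin1998WeilClasses, §1 Criterion and Lemma (1)] -/
theorem hasSemisimpleHodgeGroup_iff_forall_eigenMultiplicity_eq {φ : A ⟶ A} {P : Polynomial ℤ} {e m : ℕ} (hPm : P.Monic)
    (hPe : P.natDegree = e) (hPirr : Irreducible (P.map (Int.castRingHom ℚ)))
    (hφ : Polynomial.eval₂ (Int.castRingHom (CategoryTheory.End A)) (φ : CategoryTheory.End A) P = 0)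
    (her : e * (2 * m) = 2 * A.dim) (hm : m ≠ 0)
    (hE : ∀ u : A ⟶ A, pullbackOne A u ∈ centralizerAlgebra A → pullbackOne A u ∈ Algebra.adjoin ℂ {pullbackOne A φ}) :
    HasSemisimpleHodgeGroup A ↔
      ∀ ρ : ℂ, Polynomial.eval₂ (Int.castRingHom ℂ) ρ P = 0 → eigenMultiplicity A φ ρ = eigenMultiplicity A φ (starRingEnd ℂ ρ) :=
  ⟨fun hA _ hρ => eigenMultiplicity_eq_of_hasSemisimpleHodgeGroup hA hPm hPirr hφ hρ,
    hasSemisimpleHodgeGroup_of_forall_eigenMultiplicity_eq hPm hPe hPirr hφ her hm hE⟩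

/-- **… and `Hg(A)(ℂ)` has finite centre ⟺ `W_{ℚ(φ)}` consists of Hodge classes** (same hypotheses).
[cite: MoonenZarhin1998WeilClasses, §1 Criterion, Lemma (1) and Remark (1) after Criterion (2)] -/
theorem hasSemisimpleHodgeGroup_iff_weilClassesField_le_hodgeClassSpan {φ : A ⟶ A} {P : Polynomial ℤ} {e m : ℕ}
    (hPm : P.Monic) (hPe : P.natDegree = e) (hPirr : Irreducible (P.map (Int.castRingHom ℚ)))
    (hφ : Polynomial.eval₂ (Int.castRingHom (CategoryTheory.End A)) (φ : CategoryTheory.End A) P = 0)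
    (her : e * (2 * m) = 2 * A.dim) (hm : m ≠ 0)
    (hE : ∀ u : A ⟶ A, pullbackOne A u ∈ centralizerAlgebra A → pullbackOne A u ∈ Algebra.adjoin ℂ {pullbackOne A φ}) :
    HasSemisimpleHodgeGroup A ↔ weilClassesField A φ P (2 * m) ≤ hodgeClassSpan A.dim A.X m :=
  ⟨fun hA => weilClassesField_le_hodgeClassSpan_of_hasSemisimpleHodgeGroup hA hPm hPe hPirr hφ her,
    hasSemisimpleHodgeGroup_of_weilClassesField_le_hodgeClassSpan hPm hPe hPirr hφ her hm hE⟩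

end Converse

/-! ### §6 The numerics `e · 2m = 2 dim A`, `m ≠ 0` follow from balance: the equivalence with `dim A > 0` only -/

section Numerics

open Polynomial

variable {A : AbelianVariety ℂ}

/-- **`deg P · 2 n_ρ = 2 dim A` under the `Θ`-trace condition**: `dim V_ρ · deg P = 2 dim A` (Moonen–Zarhin «`n_σ + n_σ' =
2g/[F:ℚ]`», the tree's `finrank_eigenspace_mul_natDegree_eq`) and `dim V_ρ = n_ρ + n'_ρ = n_ρ + n_ρ̄ = 2 n_ρ` by balance
(§5). [cite: MoonenZarhin1998WeilClasses, §1 (n_σ + n_σ' = 2g/[F:ℚ]) and Criterion] [cite: Deligne1982HodgeCycles, §4 (4.4)] -/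
theorem natDegree_mul_two_mul_eigenMultiplicity_eq_of_hodgeThetaTraceCondition (hT : HodgeThetaTraceCondition A) {φ : A ⟶ A}
    {P : Polynomial ℤ} (hPm : P.Monic) (hPirr : Irreducible (P.map (Int.castRingHom ℚ)))
    (hφ : Polynomial.eval₂ (Int.castRingHom (CategoryTheory.End A)) (φ : CategoryTheory.End A) P = 0)
    {ρ : ℂ} (hρ : Polynomial.eval₂ (Int.castRingHom ℂ) ρ P = 0) :
    P.natDegree * (2 * eigenMultiplicity A φ ρ) = 2 * A.dim := by
  have hXA : IsSmoothProjective A.dim A.X := AbelianVariety.isSmoothProjective_holds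
  haveI := finite_complexBetti_abelianVariety A 1
  have h1 := finrank_eigenspace_mul_natDegree_eq hPm hPirr hφ hρ
  have h2 := finrank_eigenspace_eq_add hXA φ.hom.hom.hom ρ
  have h3 : Module.finrank ℂ ↥(Module.End.eigenspace (complexBetti.map φ.hom.hom.hom 1).hom ρ ⊓ hodgeZeroOne hXA) =
      eigenMultiplicity A φ (starRingEnd ℂ ρ) := by
    have h := finrank_eigenspace_inf_hodgeZeroOne_eq hXA φ.hom.hom.hom (starRingEnd ℂ ρ)
    rw [Complex.conj_conj] at h
    exact h
  have h4 : Module.finrank ℂ ↥(Module.End.eigenspace (complexBetti.map φ.hom.hom.hom 1).hom ρ ⊓ hodgeOneZero hXA) =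
      eigenMultiplicity A φ ρ := rfl
  rw [h3, h4, ← eigenMultiplicity_eq_of_hodgeThetaTraceCondition hT hPm hPirr hφ hρ, ← two_mul] at h2
  rw [← h1, h2, mul_comm]

/-- **`n_ρ ≠ 0`** under the `Θ`-trace condition, for `A ≠ 0`. [cite: MoonenZarhin1998WeilClasses, §1 (n_σ + n_σ' = 2g/[F:ℚ])] -/
theorem eigenMultiplicity_ne_zero_of_hodgeThetaTraceCondition (hT : HodgeThetaTraceCondition A) {φ : A ⟶ A}
    {P : Polynomial ℤ} (hPm : P.Monic) (hPirr : Irreducible (P.map (Int.castRingHom ℚ)))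
    (hφ : Polynomial.eval₂ (Int.castRingHom (CategoryTheory.End A)) (φ : CategoryTheory.End A) P = 0)
    (hA : 0 < A.dim) {ρ : ℂ} (hρ : Polynomial.eval₂ (Int.castRingHom ℂ) ρ P = 0) : eigenMultiplicity A φ ρ ≠ 0 := by
  intro h0
  have h := natDegree_mul_two_mul_eigenMultiplicity_eq_of_hodgeThetaTraceCondition hT hPm hPirr hφ hρ
  rw [h0, mul_zero, mul_zero] at h
  omega

/-- A monic polynomial irreducible over `ℚ` has a complex root. [folklore] -/
private theorem exists_complex_root {P : Polynomial ℤ} (hPirr : Irreducible (P.map (Int.castRingHom ℚ))) :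
    ∃ ρ : ℂ, Polynomial.eval₂ (Int.castRingHom ℂ) ρ P = 0 := by
  have hdeg : 0 < (P.map (Int.castRingHom ℂ)).degree := by
    rw [degree_map_eq_of_injective (RingHom.injective_int (Int.castRingHom ℂ)),
      ← degree_map_eq_of_injective (RingHom.injective_int (Int.castRingHom ℚ))]
    exact degree_pos_of_irreducible hPirr
  obtain ⟨z, hz⟩ := Complex.exists_root hdeg
  exact ⟨z, by rwa [IsRoot.def, Polynomial.eval_map] at hz⟩

/-- **The `Θ`-trace condition ⟹ finite centre of `Hg(A)(ℂ)`, when the centre of `End⁰(A)` lies in `ℚ(φ)`** — with only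
`dim A > 0` as numerical hypothesis (`e · 2m = 2 dim A` with `m = n_ρ ≠ 0` is derived from balance).
[cite: Gordon1999HodgeAVSurvey, 2.9 Proposition] [cite: MoonenZarhin1998WeilClasses, §1 Criterion, Lemma (1) and Remark (1) after Criterion (2)] -/
theorem hasSemisimpleHodgeGroup_of_hodgeThetaTraceCondition_of_dim_pos (hT : HodgeThetaTraceCondition A) {φ : A ⟶ A}
    {P : Polynomial ℤ} (hPm : P.Monic) (hPirr : Irreducible (P.map (Int.castRingHom ℚ)))
    (hφ : Polynomial.eval₂ (Int.castRingHom (CategoryTheory.End A)) (φ : CategoryTheory.End A) P = 0) (hA : 0 < A.dim)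
    (hE : ∀ u : A ⟶ A, pullbackOne A u ∈ centralizerAlgebra A → pullbackOne A u ∈ Algebra.adjoin ℂ {pullbackOne A φ}) :
    HasSemisimpleHodgeGroup A := by
  obtain ⟨ρ, hρ⟩ := exists_complex_root hPirr
  exact hasSemisimpleHodgeGroup_of_hodgeThetaTraceCondition hT hPm rfl hPirr hφ
    (natDegree_mul_two_mul_eigenMultiplicity_eq_of_hodgeThetaTraceCondition hT hPm hPirr hφ hρ)
    (eigenMultiplicity_ne_zero_of_hodgeThetaTraceCondition hT hPm hPirr hφ hA hρ) hE

/-- **GORDON 2.9 ON THE CARRIER (equivalence), minimal hypotheses**: for `A ≠ 0` whose centre `Z(End⁰(A))` acts on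
`H¹(A(ℂ); ℂ)` through `ℂ[φ^*]` for some `φ ∈ End(A)` with irreducible polynomial (e.g. `A` isotypic, `φ` generating the
centre), `Hg(A)(ℂ)` has finite centre ⟺ the `Θ`-trace condition. [cite: Gordon1999HodgeAVSurvey, 2.9 Proposition]
[cite: MoonenZarhin1998WeilClasses, §1 Criterion, Lemma (1) and Remark (1) after Criterion (2)] -/
theorem hasSemisimpleHodgeGroup_iff_hodgeThetaTraceCondition_of_dim_pos {φ : A ⟶ A} {P : Polynomial ℤ} (hPm : P.Monic)
    (hPirr : Irreducible (P.map (Int.castRingHom ℚ)))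
    (hφ : Polynomial.eval₂ (Int.castRingHom (CategoryTheory.End A)) (φ : CategoryTheory.End A) P = 0) (hA : 0 < A.dim)
    (hE : ∀ u : A ⟶ A, pullbackOne A u ∈ centralizerAlgebra A → pullbackOne A u ∈ Algebra.adjoin ℂ {pullbackOne A φ}) :
    HasSemisimpleHodgeGroup A ↔ HodgeThetaTraceCondition A :=
  ⟨hodgeThetaTraceCondition_of_hasSemisimpleHodgeGroup A,
    fun hT => hasSemisimpleHodgeGroup_of_hodgeThetaTraceCondition_of_dim_pos hT hPm hPirr hφ hA hE⟩

/-- **… and ⟺ balanced multiplicities of `φ`** (minimal hypotheses). [cite: Gordon1999HodgeAVSurvey, 2.9 Proposition]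
[cite: MoonenZarhin1998WeilClasses, §1 Criterion and Lemma (1)] -/
theorem hasSemisimpleHodgeGroup_iff_forall_eigenMultiplicity_eq_of_dim_pos {φ : A ⟶ A} {P : Polynomial ℤ} (hPm : P.Monic)
    (hPirr : Irreducible (P.map (Int.castRingHom ℚ)))
    (hφ : Polynomial.eval₂ (Int.castRingHom (CategoryTheory.End A)) (φ : CategoryTheory.End A) P = 0) (hA : 0 < A.dim)
    (hE : ∀ u : A ⟶ A, pullbackOne A u ∈ centralizerAlgebra A → pullbackOne A u ∈ Algebra.adjoin ℂ {pullbackOne A φ}) :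
    HasSemisimpleHodgeGroup A ↔
      ∀ ρ : ℂ, Polynomial.eval₂ (Int.castRingHom ℂ) ρ P = 0 → eigenMultiplicity A φ ρ = eigenMultiplicity A φ (starRingEnd ℂ ρ) := by
  refine ⟨fun h _ hρ => eigenMultiplicity_eq_of_hasSemisimpleHodgeGroup h hPm hPirr hφ hρ, fun hbal => ?_⟩
  have hT : HodgeThetaTraceCondition A := hodgeThetaTraceCondition_of_balanced hPm hPirr hφ hE hbal
  exact hasSemisimpleHodgeGroup_of_hodgeThetaTraceCondition_of_dim_pos hT hPm hPirr hφ hA hE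

end Numerics

end Literature.AlgebraicGeometry.HodgeTheory

end
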